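import Mathlib
import Summits.ValiantsHypothesis.ValiantsHypothesis.Theorems.LacunarySymmetroidMatrixDescartesCensusChamberTableA

/-!
# `MatrixDescartes` census — the CHAMBER TABLE of record, part B: blocks `81 … 162` and the table `chamber`

See part A (`…CensusChamberTableA`) for the framing: VERBATIM the TABLE BLOCK of the census line `Cruxes/DoorA26/Lines/census.lean` (crux-plan seat,
INBOX l.9133), split in two files at the top `if N < 81` of `chamberBlock` because of the 1000-line cap; the names `Census.chamberBlock`,
`Census.chamber` and all values are unchanged (the sanity `example`s `chamber 1002`, `chamber 0`, `chamber 2607` kept, by `rfl`).  ONE OMISSION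
w.r.t. the line's TABLE BLOCK: the closed `Prop` `W4BandLaw` is NOT declared here — a binder-free `def … : Prop` in a Theorems proposal is relocated to
`Literature/` by the gate (bounce p584333, 2026-08-27), and its CONTENT is already the tree theorem `Census.w4BandLaw_holds` (`…CensusWindowFourBandLaw`,
val-sym-door-p1 g9, verbatim the statement); the line file keeps its own `W4BandLaw` declaration (the republish deletes the table block up to it).
Nothing asserted; `DoorA26` OPEN; nothing on `MatrixDescartes` (stmt-ValiantsHypothesis-18050) or `VP ≠ VNP`.  Typed by val-sym-door-p1 g9 (pre-image
ce01d29e735170d8); filed by val-sym-door-p5 g6 (desk R2318 (b)/R2328 (a)) with this one omission.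

[folklore] Bookkeeping definitions.
-/

-- `Summit.ValiantsHypothesis.ValiantsHypothesis.…` repeats a component by the D-0017 layout
-- (single-conjunct summit), which the `dupNamespace` linter flags; the name is mandated.
set_option linter.dupNamespace false

namespace Summit.ValiantsHypothesis.ValiantsHypothesis.Theorems.LacunarySymmetroidMatrixDescartes.Census

set_option maxHeartbeats 4000000 in
open ChamberTable in
/-- Blocks `81 … 162` of the chamber table (see `chamberBlockLo`). [folklore] -/
noncomputable def chamberBlockHi (N : ℕ) : List (Fin 21 → Fin 6 × Fin 6) :=
 if N < 122 then
 if N < 101 then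
 if N < 91 then
 if N < 86 then
 if N < 83 then
 if N < 82 then
 [ -- block 81: chambers 1296…1311, four per line
 ![a,b,c,g,d,h,i,l,e,m,j,f,p,n,k,q,o,r,s,t,u], ![a,b,c,g,d,h,i,l,e,m,j,f,p,n,k,q,o,s,r,t,u], ![a,b,c,g,d,h,i,l,e,m,j,p,f,n,k,q,o,r,s,t,u], ![a,b,c,g,d,h,i,l,e,m,j,p,f,n,k,q,o,s,r,t,u],
 ![a,b,c,g,d,h,i,l,e,m,j,p,f,n,q,k,o,s,r,t,u], ![a,b,c,g,d,h,i,l,e,m,j,p,n,f,q,k,o,s,r,t,u], ![a,b,c,g,d,h,i,l,e,m,j,p,n,f,q,k,s,o,r,t,u], ![a,b,c,g,d,h,i,l,e,m,j,p,n,q,f,k,s,o,r,t,u],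
 ![a,b,c,g,d,h,i,l,e,m,j,p,n,q,f,s,k,o,r,t,u], ![a,b,c,g,d,h,i,l,e,m,j,p,n,q,s,f,k,o,r,t,u], ![a,b,c,g,d,h,i,l,e,m,p,f,j,k,n,q,o,r,s,t,u], ![a,b,c,g,d,h,i,l,e,m,p,f,j,n,k,q,o,r,s,t,u],
 ![a,b,c,g,d,h,i,l,e,m,p,j,f,n,k,q,o,r,s,t,u], ![a,b,c,g,d,h,i,l,e,m,p,j,f,n,q,k,o,r,s,t,u], ![a,b,c,g,d,h,i,l,e,m,p,j,f,n,q,k,o,s,r,t,u], ![a,b,c,g,d,h,i,l,e,m,p,j,n,f,q,k,o,s,r,t,u] ]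
 else
 [ -- block 82: chambers 1312…1327, four per line
 ![a,b,c,g,d,h,i,l,e,m,p,j,n,f,q,k,s,o,r,t,u], ![a,b,c,g,d,h,i,l,e,m,p,j,n,q,f,k,s,o,r,t,u], ![a,b,c,g,d,h,i,l,e,m,p,j,n,q,f,s,k,o,r,t,u], ![a,b,c,g,d,h,i,l,e,m,p,j,n,q,s,f,k,o,r,t,u],
 ![a,b,c,g,d,h,i,l,m,e,f,p,j,k,n,o,q,r,s,t,u], ![a,b,c,g,d,h,i,l,m,e,p,f,j,k,n,o,q,r,s,t,u], ![a,b,c,g,d,h,i,l,m,e,p,f,j,k,n,q,o,r,s,t,u], ![a,b,c,g,d,h,i,l,m,e,p,f,j,n,k,q,o,r,s,t,u],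
 ![a,b,c,g,d,h,i,l,m,e,p,j,f,n,k,q,o,r,s,t,u], ![a,b,c,g,d,h,i,l,m,e,p,j,f,n,q,k,o,r,s,t,u], ![a,b,c,g,d,h,i,l,m,e,p,j,n,f,q,k,o,r,s,t,u], ![a,b,c,g,d,h,i,l,m,e,p,j,n,f,q,k,o,s,r,t,u],
 ![a,b,c,g,d,h,i,l,m,e,p,j,n,q,f,k,o,s,r,t,u], ![a,b,c,g,d,h,i,l,m,e,p,j,n,q,f,k,s,o,r,t,u], ![a,b,c,g,d,h,i,l,m,e,p,j,n,q,f,s,k,o,r,t,u], ![a,b,c,g,d,h,i,l,m,e,p,j,n,q,s,f,k,o,r,t,u] ]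
 else
 if N < 84 then
 [ -- block 83: chambers 1328…1343, four per line
 ![a,b,c,g,d,h,i,l,m,p,e,f,j,k,n,o,q,r,s,t,u], ![a,b,c,g,d,h,i,l,m,p,e,f,j,k,n,q,o,r,s,t,u], ![a,b,c,g,d,h,i,l,m,p,e,f,j,n,k,q,o,r,s,t,u], ![a,b,c,g,d,h,i,l,m,p,e,j,f,n,k,q,o,r,s,t,u],
 ![a,b,c,g,d,h,i,l,m,p,e,j,f,n,q,k,o,r,s,t,u], ![a,b,c,g,d,h,i,l,m,p,e,j,n,f,q,k,o,r,s,t,u], ![a,b,c,g,d,h,i,l,m,p,e,j,n,q,f,k,o,r,s,t,u], ![a,b,c,g,d,h,i,l,m,p,e,j,n,q,f,k,o,s,r,t,u],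
 ![a,b,c,g,d,h,i,l,m,p,e,j,n,q,f,k,s,o,r,t,u], ![a,b,c,g,d,h,i,l,m,p,e,j,n,q,f,s,k,o,r,t,u], ![a,b,c,g,d,h,i,l,m,p,e,j,n,q,s,f,k,o,r,t,u], ![a,b,c,g,d,h,l,e,f,i,m,j,k,n,o,p,q,r,s,t,u],
 ![a,b,c,g,d,h,l,e,f,i,m,j,k,n,p,o,q,r,s,t,u], ![a,b,c,g,d,h,l,e,f,i,m,j,k,p,n,o,q,r,s,t,u], ![a,b,c,g,d,h,l,e,f,i,m,j,n,k,o,p,q,r,s,t,u], ![a,b,c,g,d,h,l,e,f,i,m,j,n,k,o,p,q,s,r,t,u] ]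
 else
 if N < 85 then
 [ -- block 84: chambers 1344…1359, four per line
 ![a,b,c,g,d,h,l,e,f,i,m,j,n,k,p,o,q,r,s,t,u], ![a,b,c,g,d,h,l,e,f,i,m,j,n,k,p,o,q,s,r,t,u], ![a,b,c,g,d,h,l,e,i,f,m,j,k,n,p,o,q,r,s,t,u], ![a,b,c,g,d,h,l,e,i,f,m,j,k,p,n,o,q,r,s,t,u],
 ![a,b,c,g,d,h,l,e,i,f,m,j,n,k,p,o,q,r,s,t,u], ![a,b,c,g,d,h,l,e,i,f,m,j,n,k,p,o,q,s,r,t,u], ![a,b,c,g,d,h,l,e,i,f,m,j,n,p,k,o,q,r,s,t,u], ![a,b,c,g,d,h,l,e,i,f,m,j,n,p,k,o,q,s,r,t,u],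
 ![a,b,c,g,d,h,l,e,i,f,m,j,p,k,n,o,q,r,s,t,u], ![a,b,c,g,d,h,l,e,i,f,m,j,p,n,k,o,q,r,s,t,u], ![a,b,c,g,d,h,l,e,i,m,f,j,n,p,k,o,q,r,s,t,u], ![a,b,c,g,d,h,l,e,i,m,f,j,n,p,k,o,q,s,r,t,u],
 ![a,b,c,g,d,h,l,e,i,m,f,j,n,p,k,q,o,s,r,t,u], ![a,b,c,g,d,h,l,e,i,m,f,j,p,n,k,o,q,r,s,t,u], ![a,b,c,g,d,h,l,e,i,m,f,j,p,n,k,q,o,r,s,t,u], ![a,b,c,g,d,h,l,e,i,m,f,j,p,n,k,q,o,s,r,t,u] ]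
 else
 [ -- block 85: chambers 1360…1375, four per line
 ![a,b,c,g,d,h,l,e,i,m,j,f,n,p,k,q,o,s,r,t,u], ![a,b,c,g,d,h,l,e,i,m,j,f,n,p,q,k,o,s,r,t,u], ![a,b,c,g,d,h,l,e,i,m,j,f,p,n,k,q,o,s,r,t,u], ![a,b,c,g,d,h,l,e,i,m,j,f,p,n,q,k,o,s,r,t,u],
 ![a,b,c,g,d,h,l,e,i,m,j,n,f,p,q,k,o,s,r,t,u], ![a,b,c,g,d,h,l,e,i,m,j,n,f,p,q,k,s,o,r,t,u], ![a,b,c,g,d,h,l,e,i,m,j,n,f,p,q,s,k,o,r,t,u], ![a,b,c,g,d,h,l,e,i,m,j,n,p,f,q,k,o,s,r,t,u],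
 ![a,b,c,g,d,h,l,e,i,m,j,n,p,f,q,k,s,o,r,t,u], ![a,b,c,g,d,h,l,e,i,m,j,n,p,f,q,s,k,o,r,t,u], ![a,b,c,g,d,h,l,e,i,m,j,n,p,q,f,s,k,o,r,t,u], ![a,b,c,g,d,h,l,e,i,m,j,n,p,q,s,f,k,o,r,t,u],
 ![a,b,c,g,d,h,l,e,i,m,j,p,f,n,q,k,o,s,r,t,u], ![a,b,c,g,d,h,l,e,i,m,j,p,n,f,q,k,o,s,r,t,u], ![a,b,c,g,d,h,l,e,i,m,j,p,n,f,q,k,s,o,r,t,u], ![a,b,c,g,d,h,l,e,i,m,j,p,n,f,q,s,k,o,r,t,u] ]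
 else
 if N < 88 then
 if N < 87 then
 [ -- block 86: chambers 1376…1391, four per line
 ![a,b,c,g,d,h,l,e,i,m,j,p,n,q,f,s,k,o,r,t,u], ![a,b,c,g,d,h,l,e,i,m,j,p,n,q,s,f,k,o,r,t,u], ![a,b,c,g,d,h,l,i,e,f,m,j,k,p,n,o,q,r,s,t,u], ![a,b,c,g,d,h,l,i,e,f,m,j,p,k,n,o,q,r,s,t,u],
 ![a,b,c,g,d,h,l,i,e,f,m,p,j,k,n,o,q,r,s,t,u], ![a,b,c,g,d,h,l,i,e,m,f,j,p,k,n,o,q,r,s,t,u], ![a,b,c,g,d,h,l,i,e,m,f,j,p,n,k,o,q,r,s,t,u], ![a,b,c,g,d,h,l,i,e,m,f,j,p,n,k,q,o,r,s,t,u],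
 ![a,b,c,g,d,h,l,i,e,m,f,p,j,k,n,o,q,r,s,t,u], ![a,b,c,g,d,h,l,i,e,m,f,p,j,n,k,o,q,r,s,t,u], ![a,b,c,g,d,h,l,i,e,m,f,p,j,n,k,q,o,r,s,t,u], ![a,b,c,g,d,h,l,i,e,m,j,f,p,n,k,q,o,r,s,t,u],
 ![a,b,c,g,d,h,l,i,e,m,j,f,p,n,k,q,o,s,r,t,u], ![a,b,c,g,d,h,l,i,e,m,j,p,f,n,k,q,o,r,s,t,u], ![a,b,c,g,d,h,l,i,e,m,j,p,f,n,k,q,o,s,r,t,u], ![a,b,c,g,d,h,l,i,e,m,j,p,f,n,q,k,o,s,r,t,u] ]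
 else
 [ -- block 87: chambers 1392…1407, four per line
 ![a,b,c,g,d,h,l,i,e,m,j,p,n,f,q,k,o,s,r,t,u], ![a,b,c,g,d,h,l,i,e,m,j,p,n,f,q,k,s,o,r,t,u], ![a,b,c,g,d,h,l,i,e,m,j,p,n,q,f,k,s,o,r,t,u], ![a,b,c,g,d,h,l,i,e,m,j,p,n,q,f,s,k,o,r,t,u],
 ![a,b,c,g,d,h,l,i,e,m,j,p,n,q,s,f,k,o,r,t,u], ![a,b,c,g,d,h,l,i,e,m,p,f,j,n,k,q,o,r,s,t,u], ![a,b,c,g,d,h,l,i,e,m,p,j,f,n,k,q,o,r,s,t,u], ![a,b,c,g,d,h,l,i,e,m,p,j,f,n,q,k,o,r,s,t,u],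
 ![a,b,c,g,d,h,l,i,e,m,p,j,f,n,q,k,o,s,r,t,u], ![a,b,c,g,d,h,l,i,e,m,p,j,n,f,q,k,o,s,r,t,u], ![a,b,c,g,d,h,l,i,e,m,p,j,n,f,q,k,s,o,r,t,u], ![a,b,c,g,d,h,l,i,e,m,p,j,n,q,f,k,s,o,r,t,u],
 ![a,b,c,g,d,h,l,i,e,m,p,j,n,q,f,s,k,o,r,t,u], ![a,b,c,g,d,h,l,i,e,m,p,j,n,q,s,f,k,o,r,t,u], ![a,b,c,g,d,h,l,i,m,e,f,p,j,k,n,o,q,r,s,t,u], ![a,b,c,g,d,h,l,i,m,e,f,p,j,n,k,o,q,r,s,t,u] ]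
 else
 if N < 89 then
 [ -- block 88: chambers 1408…1423, four per line
 ![a,b,c,g,d,h,l,i,m,e,p,f,j,k,n,o,q,r,s,t,u], ![a,b,c,g,d,h,l,i,m,e,p,f,j,n,k,o,q,r,s,t,u], ![a,b,c,g,d,h,l,i,m,e,p,f,j,n,k,q,o,r,s,t,u], ![a,b,c,g,d,h,l,i,m,e,p,j,f,n,k,q,o,r,s,t,u],
 ![a,b,c,g,d,h,l,i,m,e,p,j,f,n,q,k,o,r,s,t,u], ![a,b,c,g,d,h,l,i,m,e,p,j,n,f,q,k,o,r,s,t,u], ![a,b,c,g,d,h,l,i,m,e,p,j,n,f,q,k,o,s,r,t,u], ![a,b,c,g,d,h,l,i,m,e,p,j,n,q,f,k,o,s,r,t,u],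
 ![a,b,c,g,d,h,l,i,m,e,p,j,n,q,f,k,s,o,r,t,u], ![a,b,c,g,d,h,l,i,m,e,p,j,n,q,f,s,k,o,r,t,u], ![a,b,c,g,d,h,l,i,m,e,p,j,n,q,s,f,k,o,r,t,u], ![a,b,c,g,d,h,l,i,m,p,e,f,j,k,n,o,q,r,s,t,u],
 ![a,b,c,g,d,h,l,i,m,p,e,f,j,n,k,o,q,r,s,t,u], ![a,b,c,g,d,h,l,i,m,p,e,f,j,n,k,q,o,r,s,t,u], ![a,b,c,g,d,h,l,i,m,p,e,j,f,n,k,q,o,r,s,t,u], ![a,b,c,g,d,h,l,i,m,p,e,j,f,n,q,k,o,r,s,t,u] ]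
 else
 if N < 90 then
 [ -- block 89: chambers 1424…1439, four per line
 ![a,b,c,g,d,h,l,i,m,p,e,j,n,f,q,k,o,r,s,t,u], ![a,b,c,g,d,h,l,i,m,p,e,j,n,q,f,k,o,r,s,t,u], ![a,b,c,g,d,h,l,i,m,p,e,j,n,q,f,k,o,s,r,t,u], ![a,b,c,g,d,h,l,i,m,p,e,j,n,q,f,k,s,o,r,t,u],
 ![a,b,c,g,d,h,l,i,m,p,e,j,n,q,f,s,k,o,r,t,u], ![a,b,c,g,d,h,l,i,m,p,e,j,n,q,s,f,k,o,r,t,u], ![a,b,c,g,h,d,e,f,l,i,j,k,m,n,o,p,q,r,s,t,u], ![a,b,c,g,h,d,e,f,l,i,j,k,m,n,o,p,q,s,r,t,u],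
 ![a,b,c,g,h,d,e,l,f,i,j,k,m,n,o,p,q,r,s,t,u], ![a,b,c,g,h,d,e,l,f,i,j,k,m,n,o,p,q,s,r,t,u], ![a,b,c,g,h,d,e,l,f,i,j,m,k,n,o,p,q,r,s,t,u], ![a,b,c,g,h,d,e,l,f,i,j,m,k,n,o,p,q,s,r,t,u],
 ![a,b,c,g,h,d,e,l,f,i,j,m,n,k,o,p,q,s,r,t,u], ![a,b,c,g,h,d,e,l,i,f,j,m,k,n,o,p,q,r,s,t,u], ![a,b,c,g,h,d,e,l,i,f,j,m,k,n,o,p,q,s,r,t,u], ![a,b,c,g,h,d,e,l,i,f,j,m,k,n,p,o,q,r,s,t,u] ]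
 else
 [ -- block 90: chambers 1440…1455, four per line
 ![a,b,c,g,h,d,e,l,i,f,j,m,k,n,p,o,q,s,r,t,u], ![a,b,c,g,h,d,e,l,i,f,j,m,n,k,o,p,q,s,r,t,u], ![a,b,c,g,h,d,e,l,i,f,j,m,n,k,p,o,q,s,r,t,u], ![a,b,c,g,h,d,e,l,i,j,f,m,n,k,o,p,q,s,r,t,u],
 ![a,b,c,g,h,d,e,l,i,j,f,m,n,k,p,o,q,s,r,t,u], ![a,b,c,g,h,d,e,l,i,j,f,m,n,k,p,q,o,s,r,t,u], ![a,b,c,g,h,d,e,l,i,j,f,m,n,k,p,q,s,o,r,t,u], ![a,b,c,g,h,d,e,l,i,j,m,f,n,k,p,q,o,s,r,t,u],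
 ![a,b,c,g,h,d,e,l,i,j,m,f,n,k,p,q,s,o,r,t,u], ![a,b,c,g,h,d,e,l,i,j,m,f,n,p,k,q,o,s,r,t,u], ![a,b,c,g,h,d,e,l,i,j,m,f,n,p,k,q,s,o,r,t,u], ![a,b,c,g,h,d,e,l,i,j,m,n,f,k,p,q,s,o,r,t,u],
 ![a,b,c,g,h,d,e,l,i,j,m,n,f,p,k,q,s,o,r,t,u], ![a,b,c,g,h,d,e,l,i,j,m,n,f,p,q,k,s,o,r,t,u], ![a,b,c,g,h,d,e,l,i,j,m,n,f,p,q,s,k,o,r,t,u], ![a,b,c,g,h,d,e,l,i,j,m,n,p,f,q,k,s,o,r,t,u] ]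
 else
 if N < 96 then
 if N < 93 then
 if N < 92 then
 [ -- block 91: chambers 1456…1471, four per line
 ![a,b,c,g,h,d,e,l,i,j,m,n,p,f,q,s,k,o,r,t,u], ![a,b,c,g,h,d,e,l,i,j,m,n,p,q,f,s,k,o,r,t,u], ![a,b,c,g,h,d,e,l,i,j,m,n,p,q,s,f,k,o,r,t,u], ![a,b,c,g,h,d,l,e,f,i,j,k,m,n,o,p,q,r,s,t,u],
 ![a,b,c,g,h,d,l,e,f,i,j,k,m,n,o,p,q,s,r,t,u], ![a,b,c,g,h,d,l,e,f,i,j,m,k,n,o,p,q,r,s,t,u], ![a,b,c,g,h,d,l,e,f,i,j,m,k,n,o,p,q,s,r,t,u], ![a,b,c,g,h,d,l,e,f,i,j,m,n,k,o,p,q,s,r,t,u],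
 ![a,b,c,g,h,d,l,e,f,i,m,j,k,n,o,p,q,r,s,t,u], ![a,b,c,g,h,d,l,e,f,i,m,j,n,k,o,p,q,r,s,t,u], ![a,b,c,g,h,d,l,e,f,i,m,j,n,k,o,p,q,s,r,t,u], ![a,b,c,g,h,d,l,e,i,f,j,m,k,n,o,p,q,r,s,t,u],
 ![a,b,c,g,h,d,l,e,i,f,j,m,k,n,o,p,q,s,r,t,u], ![a,b,c,g,h,d,l,e,i,f,j,m,k,n,p,o,q,r,s,t,u], ![a,b,c,g,h,d,l,e,i,f,j,m,k,n,p,o,q,s,r,t,u], ![a,b,c,g,h,d,l,e,i,f,j,m,n,k,o,p,q,s,r,t,u] ]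
 else
 [ -- block 92: chambers 1472…1487, four per line
 ![a,b,c,g,h,d,l,e,i,f,j,m,n,k,p,o,q,s,r,t,u], ![a,b,c,g,h,d,l,e,i,f,m,j,k,n,o,p,q,r,s,t,u], ![a,b,c,g,h,d,l,e,i,f,m,j,k,n,p,o,q,r,s,t,u], ![a,b,c,g,h,d,l,e,i,f,m,j,n,k,o,p,q,r,s,t,u],
 ![a,b,c,g,h,d,l,e,i,f,m,j,n,k,o,p,q,s,r,t,u], ![a,b,c,g,h,d,l,e,i,f,m,j,n,k,p,o,q,r,s,t,u], ![a,b,c,g,h,d,l,e,i,f,m,j,n,k,p,o,q,s,r,t,u], ![a,b,c,g,h,d,l,e,i,j,f,m,n,k,o,p,q,s,r,t,u],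
 ![a,b,c,g,h,d,l,e,i,j,f,m,n,k,p,o,q,s,r,t,u], ![a,b,c,g,h,d,l,e,i,j,m,f,n,k,p,o,q,s,r,t,u], ![a,b,c,g,h,d,l,e,i,j,m,f,n,k,p,q,o,s,r,t,u], ![a,b,c,g,h,d,l,e,i,j,m,f,n,p,k,q,o,s,r,t,u],
 ![a,b,c,g,h,d,l,e,i,j,m,n,f,k,p,q,o,s,r,t,u], ![a,b,c,g,h,d,l,e,i,j,m,n,f,k,p,q,s,o,r,t,u], ![a,b,c,g,h,d,l,e,i,j,m,n,f,p,k,q,o,s,r,t,u], ![a,b,c,g,h,d,l,e,i,j,m,n,f,p,k,q,s,o,r,t,u] ]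
 else
 if N < 94 then
 [ -- block 93: chambers 1488…1503, four per line
 ![a,b,c,g,h,d,l,e,i,j,m,n,f,p,q,k,s,o,r,t,u], ![a,b,c,g,h,d,l,e,i,j,m,n,f,p,q,s,k,o,r,t,u], ![a,b,c,g,h,d,l,e,i,j,m,n,p,f,q,k,s,o,r,t,u], ![a,b,c,g,h,d,l,e,i,j,m,n,p,f,q,s,k,o,r,t,u],
 ![a,b,c,g,h,d,l,e,i,j,m,n,p,q,f,s,k,o,r,t,u], ![a,b,c,g,h,d,l,e,i,j,m,n,p,q,s,f,k,o,r,t,u], ![a,b,c,g,h,d,l,e,i,m,f,j,n,k,p,o,q,r,s,t,u], ![a,b,c,g,h,d,l,e,i,m,f,j,n,k,p,o,q,s,r,t,u],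
 ![a,b,c,g,h,d,l,e,i,m,f,j,n,p,k,o,q,r,s,t,u], ![a,b,c,g,h,d,l,e,i,m,f,j,n,p,k,o,q,s,r,t,u], ![a,b,c,g,h,d,l,e,i,m,j,f,n,k,p,o,q,s,r,t,u], ![a,b,c,g,h,d,l,e,i,m,j,f,n,p,k,o,q,s,r,t,u],
 ![a,b,c,g,h,d,l,e,i,m,j,f,n,p,k,q,o,s,r,t,u], ![a,b,c,g,h,d,l,e,i,m,j,n,f,p,k,q,o,s,r,t,u], ![a,b,c,g,h,d,l,e,i,m,j,n,f,p,q,k,o,s,r,t,u], ![a,b,c,g,h,d,l,e,i,m,j,n,f,p,q,k,s,o,r,t,u] ]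
 else
 if N < 95 then
 [ -- block 94: chambers 1504…1519, four per line
 ![a,b,c,g,h,d,l,e,i,m,j,n,f,p,q,s,k,o,r,t,u], ![a,b,c,g,h,d,l,e,i,m,j,n,p,f,q,k,o,s,r,t,u], ![a,b,c,g,h,d,l,e,i,m,j,n,p,f,q,k,s,o,r,t,u], ![a,b,c,g,h,d,l,e,i,m,j,n,p,f,q,s,k,o,r,t,u],
 ![a,b,c,g,h,d,l,e,i,m,j,n,p,q,f,s,k,o,r,t,u], ![a,b,c,g,h,d,l,e,i,m,j,n,p,q,s,f,k,o,r,t,u], ![a,b,c,g,h,d,l,i,e,f,m,j,k,n,o,p,q,r,s,t,u], ![a,b,c,g,h,d,l,i,e,f,m,j,k,n,p,o,q,r,s,t,u],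
 ![a,b,c,g,h,d,l,i,e,f,m,j,k,p,n,o,q,r,s,t,u], ![a,b,c,g,h,d,l,i,e,m,f,j,k,n,p,o,q,r,s,t,u], ![a,b,c,g,h,d,l,i,e,m,f,j,k,p,n,o,q,r,s,t,u], ![a,b,c,g,h,d,l,i,e,m,f,j,n,k,p,o,q,r,s,t,u],
 ![a,b,c,g,h,d,l,i,e,m,f,j,n,p,k,o,q,r,s,t,u], ![a,b,c,g,h,d,l,i,e,m,f,j,p,k,n,o,q,r,s,t,u], ![a,b,c,g,h,d,l,i,e,m,f,j,p,n,k,o,q,r,s,t,u], ![a,b,c,g,h,d,l,i,e,m,j,f,n,k,p,o,q,r,s,t,u] ]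
 else
 [ -- block 95: chambers 1520…1535, four per line
 ![a,b,c,g,h,d,l,i,e,m,j,f,n,k,p,o,q,s,r,t,u], ![a,b,c,g,h,d,l,i,e,m,j,f,n,p,k,o,q,r,s,t,u], ![a,b,c,g,h,d,l,i,e,m,j,f,n,p,k,o,q,s,r,t,u], ![a,b,c,g,h,d,l,i,e,m,j,f,n,p,k,q,o,s,r,t,u],
 ![a,b,c,g,h,d,l,i,e,m,j,f,p,n,k,o,q,r,s,t,u], ![a,b,c,g,h,d,l,i,e,m,j,f,p,n,k,q,o,r,s,t,u], ![a,b,c,g,h,d,l,i,e,m,j,f,p,n,k,q,o,s,r,t,u], ![a,b,c,g,h,d,l,i,e,m,j,n,f,p,k,q,o,s,r,t,u],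
 ![a,b,c,g,h,d,l,i,e,m,j,n,p,f,k,q,o,s,r,t,u], ![a,b,c,g,h,d,l,i,e,m,j,n,p,f,q,k,o,s,r,t,u], ![a,b,c,g,h,d,l,i,e,m,j,n,p,f,q,k,s,o,r,t,u], ![a,b,c,g,h,d,l,i,e,m,j,n,p,q,f,k,s,o,r,t,u],
 ![a,b,c,g,h,d,l,i,e,m,j,n,p,q,f,s,k,o,r,t,u], ![a,b,c,g,h,d,l,i,e,m,j,n,p,q,s,f,k,o,r,t,u], ![a,b,c,g,h,d,l,i,e,m,j,p,f,n,k,q,o,r,s,t,u], ![a,b,c,g,h,d,l,i,e,m,j,p,f,n,k,q,o,s,r,t,u] ]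
 else
 if N < 98 then
 if N < 97 then
 [ -- block 96: chambers 1536…1551, four per line
 ![a,b,c,g,h,d,l,i,e,m,j,p,n,f,k,q,o,s,r,t,u], ![a,b,c,g,h,d,l,i,e,m,j,p,n,f,q,k,o,s,r,t,u], ![a,b,c,g,h,d,l,i,e,m,j,p,n,f,q,k,s,o,r,t,u], ![a,b,c,g,h,d,l,i,e,m,j,p,n,q,f,k,s,o,r,t,u],
 ![a,b,c,g,h,d,l,i,e,m,j,p,n,q,f,s,k,o,r,t,u], ![a,b,c,g,h,d,l,i,e,m,j,p,n,q,s,f,k,o,r,t,u], ![a,b,c,g,h,d,l,i,m,e,f,j,k,p,n,o,q,r,s,t,u], ![a,b,c,g,h,d,l,i,m,e,f,j,p,k,n,o,q,r,s,t,u],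
 ![a,b,c,g,h,d,l,i,m,e,f,j,p,n,k,o,q,r,s,t,u], ![a,b,c,g,h,d,l,i,m,e,f,p,j,k,n,o,q,r,s,t,u], ![a,b,c,g,h,d,l,i,m,e,f,p,j,n,k,o,q,r,s,t,u], ![a,b,c,g,h,d,l,i,m,e,j,f,p,n,k,o,q,r,s,t,u],
 ![a,b,c,g,h,d,l,i,m,e,j,p,f,n,k,o,q,r,s,t,u], ![a,b,c,g,h,d,l,i,m,e,j,p,f,n,k,q,o,r,s,t,u], ![a,b,c,g,h,d,l,i,m,e,j,p,n,f,k,q,o,r,s,t,u], ![a,b,c,g,h,d,l,i,m,e,j,p,n,f,k,q,o,s,r,t,u] ]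
 else
 [ -- block 97: chambers 1552…1567, four per line
 ![a,b,c,g,h,d,l,i,m,e,j,p,n,f,q,k,o,s,r,t,u], ![a,b,c,g,h,d,l,i,m,e,j,p,n,q,f,k,o,s,r,t,u], ![a,b,c,g,h,d,l,i,m,e,j,p,n,q,f,k,s,o,r,t,u], ![a,b,c,g,h,d,l,i,m,e,j,p,n,q,f,s,k,o,r,t,u],
 ![a,b,c,g,h,d,l,i,m,e,j,p,n,q,s,f,k,o,r,t,u], ![a,b,c,g,h,d,l,i,m,e,p,f,j,k,n,o,q,r,s,t,u], ![a,b,c,g,h,d,l,i,m,e,p,f,j,n,k,o,q,r,s,t,u], ![a,b,c,g,h,d,l,i,m,e,p,j,f,n,k,o,q,r,s,t,u],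
 ![a,b,c,g,h,d,l,i,m,e,p,j,f,n,k,q,o,r,s,t,u], ![a,b,c,g,h,d,l,i,m,e,p,j,n,f,k,q,o,r,s,t,u], ![a,b,c,g,h,d,l,i,m,e,p,j,n,f,q,k,o,r,s,t,u], ![a,b,c,g,h,d,l,i,m,e,p,j,n,f,q,k,o,s,r,t,u],
 ![a,b,c,g,h,d,l,i,m,e,p,j,n,q,f,k,o,s,r,t,u], ![a,b,c,g,h,d,l,i,m,e,p,j,n,q,f,k,s,o,r,t,u], ![a,b,c,g,h,d,l,i,m,e,p,j,n,q,f,s,k,o,r,t,u], ![a,b,c,g,h,d,l,i,m,e,p,j,n,q,s,f,k,o,r,t,u] ]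
 else
 if N < 99 then
 [ -- block 98: chambers 1568…1583, four per line
 ![a,b,c,g,h,d,l,i,m,p,e,f,j,k,n,o,q,r,s,t,u], ![a,b,c,g,h,d,l,i,m,p,e,f,j,n,k,o,q,r,s,t,u], ![a,b,c,g,h,d,l,i,m,p,e,j,f,n,k,o,q,r,s,t,u], ![a,b,c,g,h,d,l,i,m,p,e,j,f,n,k,q,o,r,s,t,u],
 ![a,b,c,g,h,d,l,i,m,p,e,j,n,f,k,q,o,r,s,t,u], ![a,b,c,g,h,d,l,i,m,p,e,j,n,f,q,k,o,r,s,t,u], ![a,b,c,g,h,d,l,i,m,p,e,j,n,q,f,k,o,r,s,t,u], ![a,b,c,g,h,d,l,i,m,p,e,j,n,q,f,k,o,s,r,t,u],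
 ![a,b,c,g,h,d,l,i,m,p,e,j,n,q,f,k,s,o,r,t,u], ![a,b,c,g,h,d,l,i,m,p,e,j,n,q,f,s,k,o,r,t,u], ![a,b,c,g,h,d,l,i,m,p,e,j,n,q,s,f,k,o,r,t,u], ![a,b,c,g,h,l,d,e,f,i,j,k,m,n,o,p,q,r,s,t,u],
 ![a,b,c,g,h,l,d,e,f,i,j,k,m,n,o,p,q,s,r,t,u], ![a,b,c,g,h,l,d,e,f,i,j,m,k,n,o,p,q,r,s,t,u], ![a,b,c,g,h,l,d,e,f,i,j,m,k,n,o,p,q,s,r,t,u], ![a,b,c,g,h,l,d,e,f,i,j,m,n,k,o,p,q,s,r,t,u] ]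
 else
 if N < 100 then
 [ -- block 99: chambers 1584…1599, four per line
 ![a,b,c,g,h,l,d,e,f,i,m,j,k,n,o,p,q,r,s,t,u], ![a,b,c,g,h,l,d,e,f,i,m,j,n,k,o,p,q,r,s,t,u], ![a,b,c,g,h,l,d,e,f,i,m,j,n,k,o,p,q,s,r,t,u], ![a,b,c,g,h,l,d,e,i,f,j,m,k,n,o,p,q,r,s,t,u],
 ![a,b,c,g,h,l,d,e,i,f,j,m,k,n,o,p,q,s,r,t,u], ![a,b,c,g,h,l,d,e,i,f,j,m,n,k,o,p,q,s,r,t,u], ![a,b,c,g,h,l,d,e,i,f,m,j,k,n,o,p,q,r,s,t,u], ![a,b,c,g,h,l,d,e,i,f,m,j,n,k,o,p,q,r,s,t,u],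
 ![a,b,c,g,h,l,d,e,i,f,m,j,n,k,o,p,q,s,r,t,u], ![a,b,c,g,h,l,d,e,i,j,f,m,n,k,o,p,q,s,r,t,u], ![a,b,c,g,h,l,d,e,i,j,m,f,n,k,o,p,q,s,r,t,u], ![a,b,c,g,h,l,d,e,i,j,m,f,n,k,p,o,q,s,r,t,u],
 ![a,b,c,g,h,l,d,e,i,j,m,n,f,k,o,p,q,s,r,t,u], ![a,b,c,g,h,l,d,e,i,j,m,n,f,k,p,o,q,s,r,t,u], ![a,b,c,g,h,l,d,e,i,j,m,n,f,k,p,q,o,s,r,t,u], ![a,b,c,g,h,l,d,e,i,j,m,n,f,k,p,q,s,o,r,t,u] ]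
 else
 [ -- block 100: chambers 1600…1615, four per line
 ![a,b,c,g,h,l,d,e,i,j,m,n,f,p,k,q,o,s,r,t,u], ![a,b,c,g,h,l,d,e,i,j,m,n,f,p,k,q,s,o,r,t,u], ![a,b,c,g,h,l,d,e,i,j,m,n,f,p,q,k,s,o,r,t,u], ![a,b,c,g,h,l,d,e,i,j,m,n,f,p,q,s,k,o,r,t,u],
 ![a,b,c,g,h,l,d,e,i,j,m,n,p,f,q,k,s,o,r,t,u], ![a,b,c,g,h,l,d,e,i,j,m,n,p,f,q,s,k,o,r,t,u], ![a,b,c,g,h,l,d,e,i,j,m,n,p,q,f,s,k,o,r,t,u], ![a,b,c,g,h,l,d,e,i,j,m,n,p,q,s,f,k,o,r,t,u],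
 ![a,b,c,g,h,l,d,e,i,m,f,j,n,k,o,p,q,r,s,t,u], ![a,b,c,g,h,l,d,e,i,m,f,j,n,k,o,p,q,s,r,t,u], ![a,b,c,g,h,l,d,e,i,m,f,j,n,k,p,o,q,r,s,t,u], ![a,b,c,g,h,l,d,e,i,m,f,j,n,k,p,o,q,s,r,t,u],
 ![a,b,c,g,h,l,d,e,i,m,f,j,n,p,k,o,q,r,s,t,u], ![a,b,c,g,h,l,d,e,i,m,f,j,n,p,k,o,q,s,r,t,u], ![a,b,c,g,h,l,d,e,i,m,j,f,n,k,o,p,q,s,r,t,u], ![a,b,c,g,h,l,d,e,i,m,j,f,n,k,p,o,q,s,r,t,u] ]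
 else
 if N < 111 then
 if N < 106 then
 if N < 103 then
 if N < 102 then
 [ -- block 101: chambers 1616…1631, four per line
 ![a,b,c,g,h,l,d,e,i,m,j,f,n,p,k,o,q,s,r,t,u], ![a,b,c,g,h,l,d,e,i,m,j,n,f,k,o,p,q,s,r,t,u], ![a,b,c,g,h,l,d,e,i,m,j,n,f,k,p,o,q,s,r,t,u], ![a,b,c,g,h,l,d,e,i,m,j,n,f,p,k,o,q,s,r,t,u],
 ![a,b,c,g,h,l,d,e,i,m,j,n,f,p,k,q,o,s,r,t,u], ![a,b,c,g,h,l,d,e,i,m,j,n,f,p,q,k,o,s,r,t,u], ![a,b,c,g,h,l,d,e,i,m,j,n,f,p,q,k,s,o,r,t,u], ![a,b,c,g,h,l,d,e,i,m,j,n,f,p,q,s,k,o,r,t,u],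
 ![a,b,c,g,h,l,d,e,i,m,j,n,p,f,q,k,o,s,r,t,u], ![a,b,c,g,h,l,d,e,i,m,j,n,p,f,q,k,s,o,r,t,u], ![a,b,c,g,h,l,d,e,i,m,j,n,p,f,q,s,k,o,r,t,u], ![a,b,c,g,h,l,d,e,i,m,j,n,p,q,f,s,k,o,r,t,u],
 ![a,b,c,g,h,l,d,e,i,m,j,n,p,q,s,f,k,o,r,t,u], ![a,b,c,g,h,l,d,i,e,f,m,j,k,n,o,p,q,r,s,t,u], ![a,b,c,g,h,l,d,i,e,m,f,j,k,n,o,p,q,r,s,t,u], ![a,b,c,g,h,l,d,i,e,m,f,j,k,n,p,o,q,r,s,t,u] ]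
 else
 [ -- block 102: chambers 1632…1647, four per line
 ![a,b,c,g,h,l,d,i,e,m,f,j,n,k,o,p,q,r,s,t,u], ![a,b,c,g,h,l,d,i,e,m,f,j,n,k,p,o,q,r,s,t,u], ![a,b,c,g,h,l,d,i,e,m,f,j,n,p,k,o,q,r,s,t,u], ![a,b,c,g,h,l,d,i,e,m,j,f,n,k,o,p,q,r,s,t,u],
 ![a,b,c,g,h,l,d,i,e,m,j,f,n,k,o,p,q,s,r,t,u], ![a,b,c,g,h,l,d,i,e,m,j,f,n,k,p,o,q,r,s,t,u], ![a,b,c,g,h,l,d,i,e,m,j,f,n,k,p,o,q,s,r,t,u], ![a,b,c,g,h,l,d,i,e,m,j,f,n,p,k,o,q,r,s,t,u],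
 ![a,b,c,g,h,l,d,i,e,m,j,f,n,p,k,o,q,s,r,t,u], ![a,b,c,g,h,l,d,i,e,m,j,n,f,k,o,p,q,s,r,t,u], ![a,b,c,g,h,l,d,i,e,m,j,n,f,k,p,o,q,s,r,t,u], ![a,b,c,g,h,l,d,i,e,m,j,n,f,p,k,o,q,s,r,t,u],
 ![a,b,c,g,h,l,d,i,e,m,j,n,f,p,k,q,o,s,r,t,u], ![a,b,c,g,h,l,d,i,e,m,j,n,p,f,k,q,o,s,r,t,u], ![a,b,c,g,h,l,d,i,e,m,j,n,p,f,q,k,o,s,r,t,u], ![a,b,c,g,h,l,d,i,e,m,j,n,p,f,q,k,s,o,r,t,u] ]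
 else
 if N < 104 then
 [ -- block 103: chambers 1648…1663, four per line
 ![a,b,c,g,h,l,d,i,e,m,j,n,p,q,f,k,s,o,r,t,u], ![a,b,c,g,h,l,d,i,e,m,j,n,p,q,f,s,k,o,r,t,u], ![a,b,c,g,h,l,d,i,e,m,j,n,p,q,s,f,k,o,r,t,u], ![a,b,c,g,h,l,d,i,m,e,f,j,k,n,o,p,q,r,s,t,u],
 ![a,b,c,g,h,l,d,i,m,e,f,j,k,n,p,o,q,r,s,t,u], ![a,b,c,g,h,l,d,i,m,e,f,j,k,p,n,o,q,r,s,t,u], ![a,b,c,g,h,l,d,i,m,e,f,j,n,k,o,p,q,r,s,t,u], ![a,b,c,g,h,l,d,i,m,e,f,j,n,k,p,o,q,r,s,t,u],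
 ![a,b,c,g,h,l,d,i,m,e,f,j,n,p,k,o,q,r,s,t,u], ![a,b,c,g,h,l,d,i,m,e,f,j,p,k,n,o,q,r,s,t,u], ![a,b,c,g,h,l,d,i,m,e,f,j,p,n,k,o,q,r,s,t,u], ![a,b,c,g,h,l,d,i,m,e,f,p,j,k,n,o,q,r,s,t,u],
 ![a,b,c,g,h,l,d,i,m,e,f,p,j,n,k,o,q,r,s,t,u], ![a,b,c,g,h,l,d,i,m,e,j,f,n,k,o,p,q,r,s,t,u], ![a,b,c,g,h,l,d,i,m,e,j,f,n,k,p,o,q,r,s,t,u], ![a,b,c,g,h,l,d,i,m,e,j,f,n,p,k,o,q,r,s,t,u] ]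
 else
 if N < 105 then
 [ -- block 104: chambers 1664…1679, four per line
 ![a,b,c,g,h,l,d,i,m,e,j,f,p,n,k,o,q,r,s,t,u], ![a,b,c,g,h,l,d,i,m,e,j,n,f,k,o,p,q,r,s,t,u], ![a,b,c,g,h,l,d,i,m,e,j,n,f,k,o,p,q,s,r,t,u], ![a,b,c,g,h,l,d,i,m,e,j,n,f,k,p,o,q,r,s,t,u],
 ![a,b,c,g,h,l,d,i,m,e,j,n,f,k,p,o,q,s,r,t,u], ![a,b,c,g,h,l,d,i,m,e,j,n,f,p,k,o,q,r,s,t,u], ![a,b,c,g,h,l,d,i,m,e,j,n,f,p,k,o,q,s,r,t,u], ![a,b,c,g,h,l,d,i,m,e,j,n,p,f,k,o,q,r,s,t,u],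
 ![a,b,c,g,h,l,d,i,m,e,j,n,p,f,k,o,q,s,r,t,u], ![a,b,c,g,h,l,d,i,m,e,j,n,p,f,k,q,o,s,r,t,u], ![a,b,c,g,h,l,d,i,m,e,j,n,p,f,q,k,o,s,r,t,u], ![a,b,c,g,h,l,d,i,m,e,j,n,p,q,f,k,o,s,r,t,u],
 ![a,b,c,g,h,l,d,i,m,e,j,n,p,q,f,k,s,o,r,t,u], ![a,b,c,g,h,l,d,i,m,e,j,n,p,q,f,s,k,o,r,t,u], ![a,b,c,g,h,l,d,i,m,e,j,n,p,q,s,f,k,o,r,t,u], ![a,b,c,g,h,l,d,i,m,e,j,p,f,n,k,o,q,r,s,t,u] ]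
 else
 [ -- block 105: chambers 1680…1695, four per line
 ![a,b,c,g,h,l,d,i,m,e,j,p,n,f,k,o,q,r,s,t,u], ![a,b,c,g,h,l,d,i,m,e,j,p,n,f,k,q,o,r,s,t,u], ![a,b,c,g,h,l,d,i,m,e,j,p,n,f,k,q,o,s,r,t,u], ![a,b,c,g,h,l,d,i,m,e,j,p,n,f,q,k,o,s,r,t,u],
 ![a,b,c,g,h,l,d,i,m,e,j,p,n,q,f,k,o,s,r,t,u], ![a,b,c,g,h,l,d,i,m,e,j,p,n,q,f,k,s,o,r,t,u], ![a,b,c,g,h,l,d,i,m,e,j,p,n,q,f,s,k,o,r,t,u], ![a,b,c,g,h,l,d,i,m,e,j,p,n,q,s,f,k,o,r,t,u],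
 ![a,b,c,g,h,l,d,i,m,e,p,f,j,k,n,o,q,r,s,t,u], ![a,b,c,g,h,l,d,i,m,e,p,f,j,n,k,o,q,r,s,t,u], ![a,b,c,g,h,l,d,i,m,e,p,j,f,n,k,o,q,r,s,t,u], ![a,b,c,g,h,l,d,i,m,e,p,j,n,f,k,o,q,r,s,t,u],
 ![a,b,c,g,h,l,d,i,m,e,p,j,n,f,k,q,o,r,s,t,u], ![a,b,c,g,h,l,d,i,m,e,p,j,n,f,q,k,o,r,s,t,u], ![a,b,c,g,h,l,d,i,m,e,p,j,n,f,q,k,o,s,r,t,u], ![a,b,c,g,h,l,d,i,m,e,p,j,n,q,f,k,o,s,r,t,u] ]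
 else
 if N < 108 then
 if N < 107 then
 [ -- block 106: chambers 1696…1711, four per line
 ![a,b,c,g,h,l,d,i,m,e,p,j,n,q,f,k,s,o,r,t,u], ![a,b,c,g,h,l,d,i,m,e,p,j,n,q,f,s,k,o,r,t,u], ![a,b,c,g,h,l,d,i,m,e,p,j,n,q,s,f,k,o,r,t,u], ![a,b,c,g,h,l,d,i,m,p,e,f,j,k,n,o,q,r,s,t,u],
 ![a,b,c,g,h,l,d,i,m,p,e,f,j,n,k,o,q,r,s,t,u], ![a,b,c,g,h,l,d,i,m,p,e,j,f,n,k,o,q,r,s,t,u], ![a,b,c,g,h,l,d,i,m,p,e,j,n,f,k,o,q,r,s,t,u], ![a,b,c,g,h,l,d,i,m,p,e,j,n,f,k,q,o,r,s,t,u],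
 ![a,b,c,g,h,l,d,i,m,p,e,j,n,f,q,k,o,r,s,t,u], ![a,b,c,g,h,l,d,i,m,p,e,j,n,q,f,k,o,r,s,t,u], ![a,b,c,g,h,l,d,i,m,p,e,j,n,q,f,k,o,s,r,t,u], ![a,b,c,g,h,l,d,i,m,p,e,j,n,q,f,k,s,o,r,t,u],
 ![a,b,c,g,h,l,d,i,m,p,e,j,n,q,f,s,k,o,r,t,u], ![a,b,c,g,h,l,d,i,m,p,e,j,n,q,s,f,k,o,r,t,u], ![a,b,g,c,d,e,f,h,i,j,k,l,m,n,o,p,q,r,s,t,u], ![a,b,g,c,d,e,f,h,i,j,k,l,m,n,o,p,q,s,r,t,u] ]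
 else
 [ -- block 107: chambers 1712…1727, four per line
 ![a,b,g,c,d,e,f,h,i,j,k,l,m,n,p,o,q,r,s,t,u], ![a,b,g,c,d,e,f,h,i,j,k,l,m,n,p,o,q,s,r,t,u], ![a,b,g,c,d,e,f,h,i,j,k,l,m,n,p,q,o,s,r,t,u], ![a,b,g,c,d,e,f,h,i,j,k,l,m,n,p,q,s,o,r,t,u],
 ![a,b,g,c,d,e,f,h,i,j,k,l,m,p,n,o,q,r,s,t,u], ![a,b,g,c,d,e,f,h,i,j,k,l,m,p,n,q,o,r,s,t,u], ![a,b,g,c,d,e,f,h,i,j,k,l,m,p,n,q,o,s,r,t,u], ![a,b,g,c,d,e,f,h,i,j,k,l,m,p,n,q,s,o,r,t,u],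
 ![a,b,g,c,d,e,h,f,i,j,k,l,m,n,o,p,q,r,s,t,u], ![a,b,g,c,d,e,h,f,i,j,k,l,m,n,o,p,q,s,r,t,u], ![a,b,g,c,d,e,h,f,i,j,k,l,m,n,p,o,q,r,s,t,u], ![a,b,g,c,d,e,h,f,i,j,k,l,m,n,p,o,q,s,r,t,u],
 ![a,b,g,c,d,e,h,f,i,j,k,l,m,n,p,q,o,s,r,t,u], ![a,b,g,c,d,e,h,f,i,j,k,l,m,n,p,q,s,o,r,t,u], ![a,b,g,c,d,e,h,f,i,j,k,l,m,p,n,o,q,r,s,t,u], ![a,b,g,c,d,e,h,f,i,j,k,l,m,p,n,q,o,r,s,t,u] ]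
 else
 if N < 109 then
 [ -- block 108: chambers 1728…1743, four per line
 ![a,b,g,c,d,e,h,f,i,j,k,l,m,p,n,q,o,s,r,t,u], ![a,b,g,c,d,e,h,f,i,j,k,l,m,p,n,q,s,o,r,t,u], ![a,b,g,c,d,e,h,f,i,j,l,k,m,n,o,p,q,r,s,t,u], ![a,b,g,c,d,e,h,f,i,j,l,k,m,n,o,p,q,s,r,t,u],
 ![a,b,g,c,d,e,h,f,i,j,l,k,m,n,p,o,q,r,s,t,u], ![a,b,g,c,d,e,h,f,i,j,l,k,m,n,p,o,q,s,r,t,u], ![a,b,g,c,d,e,h,f,i,j,l,k,m,n,p,q,o,s,r,t,u], ![a,b,g,c,d,e,h,f,i,j,l,k,m,n,p,q,s,o,r,t,u],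
 ![a,b,g,c,d,e,h,f,i,j,l,k,m,p,n,o,q,r,s,t,u], ![a,b,g,c,d,e,h,f,i,j,l,k,m,p,n,q,o,r,s,t,u], ![a,b,g,c,d,e,h,f,i,j,l,k,m,p,n,q,o,s,r,t,u], ![a,b,g,c,d,e,h,f,i,j,l,k,m,p,n,q,s,o,r,t,u],
 ![a,b,g,c,d,e,h,i,f,j,k,l,m,n,p,q,o,s,r,t,u], ![a,b,g,c,d,e,h,i,f,j,k,l,m,n,p,q,s,o,r,t,u], ![a,b,g,c,d,e,h,i,f,j,k,l,m,p,n,q,o,r,s,t,u], ![a,b,g,c,d,e,h,i,f,j,k,l,m,p,n,q,o,s,r,t,u] ]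
 else
 if N < 110 then
 [ -- block 109: chambers 1744…1759, four per line
 ![a,b,g,c,d,e,h,i,f,j,k,l,m,p,n,q,s,o,r,t,u], ![a,b,g,c,d,e,h,i,f,j,l,k,m,n,p,q,o,s,r,t,u], ![a,b,g,c,d,e,h,i,f,j,l,k,m,n,p,q,s,o,r,t,u], ![a,b,g,c,d,e,h,i,f,j,l,k,m,p,n,q,o,r,s,t,u],
 ![a,b,g,c,d,e,h,i,f,j,l,k,m,p,n,q,o,s,r,t,u], ![a,b,g,c,d,e,h,i,f,j,l,k,m,p,n,q,s,o,r,t,u], ![a,b,g,c,d,e,h,i,f,j,l,m,k,n,p,q,o,s,r,t,u], ![a,b,g,c,d,e,h,i,f,j,l,m,k,n,p,q,s,o,r,t,u],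
 ![a,b,g,c,d,e,h,i,f,j,l,m,k,p,n,q,o,r,s,t,u], ![a,b,g,c,d,e,h,i,f,j,l,m,k,p,n,q,o,s,r,t,u], ![a,b,g,c,d,e,h,i,f,j,l,m,k,p,n,q,s,o,r,t,u], ![a,b,g,c,d,e,h,i,f,j,l,m,p,k,n,q,o,r,s,t,u],
 ![a,b,g,c,d,e,h,i,f,j,l,m,p,k,n,q,o,s,r,t,u], ![a,b,g,c,d,e,h,i,f,j,l,m,p,k,n,q,s,o,r,t,u], ![a,b,g,c,d,e,h,i,j,f,k,l,m,n,p,q,s,o,r,t,u], ![a,b,g,c,d,e,h,i,j,f,k,l,m,p,n,q,s,o,r,t,u] ]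
 else
 [ -- block 110: chambers 1760…1775, four per line
 ![a,b,g,c,d,e,h,i,j,f,l,k,m,n,p,q,s,o,r,t,u], ![a,b,g,c,d,e,h,i,j,f,l,k,m,p,n,q,s,o,r,t,u], ![a,b,g,c,d,e,h,i,j,f,l,m,k,n,p,q,s,o,r,t,u], ![a,b,g,c,d,e,h,i,j,f,l,m,k,p,n,q,s,o,r,t,u],
 ![a,b,g,c,d,e,h,i,j,f,l,m,n,k,p,q,s,o,r,t,u], ![a,b,g,c,d,e,h,i,j,f,l,m,n,p,k,q,s,o,r,t,u], ![a,b,g,c,d,e,h,i,j,f,l,m,n,p,q,k,s,o,r,t,u], ![a,b,g,c,d,e,h,i,j,f,l,m,n,p,q,s,k,o,r,t,u],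
 ![a,b,g,c,d,e,h,i,j,f,l,m,p,k,n,q,s,o,r,t,u], ![a,b,g,c,d,e,h,i,j,f,l,m,p,n,k,q,s,o,r,t,u], ![a,b,g,c,d,e,h,i,j,f,l,m,p,n,q,k,s,o,r,t,u], ![a,b,g,c,d,e,h,i,j,f,l,m,p,n,q,s,k,o,r,t,u],
 ![a,b,g,c,d,e,h,i,j,l,f,m,n,k,p,q,s,o,r,t,u], ![a,b,g,c,d,e,h,i,j,l,f,m,n,p,k,q,s,o,r,t,u], ![a,b,g,c,d,e,h,i,j,l,f,m,n,p,q,k,s,o,r,t,u], ![a,b,g,c,d,e,h,i,j,l,f,m,n,p,q,s,k,o,r,t,u] ]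
 else
 if N < 116 then
 if N < 113 then
 if N < 112 then
 [ -- block 111: chambers 1776…1791, four per line
 ![a,b,g,c,d,e,h,i,j,l,f,m,p,n,k,q,s,o,r,t,u], ![a,b,g,c,d,e,h,i,j,l,f,m,p,n,q,k,s,o,r,t,u], ![a,b,g,c,d,e,h,i,j,l,f,m,p,n,q,s,k,o,r,t,u], ![a,b,g,c,d,e,h,i,j,l,m,f,n,p,q,k,s,o,r,t,u],
 ![a,b,g,c,d,e,h,i,j,l,m,f,n,p,q,s,k,o,r,t,u], ![a,b,g,c,d,e,h,i,j,l,m,f,p,n,q,k,s,o,r,t,u], ![a,b,g,c,d,e,h,i,j,l,m,f,p,n,q,s,k,o,r,t,u], ![a,b,g,c,d,e,h,i,j,l,m,n,f,p,q,s,k,o,r,t,u],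
 ![a,b,g,c,d,e,h,i,j,l,m,n,p,f,q,s,k,o,r,t,u], ![a,b,g,c,d,e,h,i,j,l,m,n,p,q,f,s,k,o,r,t,u], ![a,b,g,c,d,e,h,i,j,l,m,n,p,q,s,f,k,o,r,t,u], ![a,b,g,c,d,e,h,i,j,l,m,p,f,n,q,k,s,o,r,t,u],
 ![a,b,g,c,d,e,h,i,j,l,m,p,f,n,q,s,k,o,r,t,u], ![a,b,g,c,d,e,h,i,j,l,m,p,n,f,q,s,k,o,r,t,u], ![a,b,g,c,d,e,h,i,j,l,m,p,n,q,f,s,k,o,r,t,u], ![a,b,g,c,d,e,h,i,j,l,m,p,n,q,s,f,k,o,r,t,u] ]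
 else
 [ -- block 112: chambers 1792…1807, four per line
 ![a,b,g,c,d,h,e,f,i,j,k,l,m,n,o,p,q,r,s,t,u], ![a,b,g,c,d,h,e,f,i,j,k,l,m,n,o,p,q,s,r,t,u], ![a,b,g,c,d,h,e,f,i,j,k,l,m,n,p,o,q,r,s,t,u], ![a,b,g,c,d,h,e,f,i,j,k,l,m,n,p,o,q,s,r,t,u],
 ![a,b,g,c,d,h,e,f,i,j,k,l,m,p,n,o,q,r,s,t,u], ![a,b,g,c,d,h,e,f,i,j,l,k,m,n,o,p,q,r,s,t,u], ![a,b,g,c,d,h,e,f,i,j,l,k,m,n,o,p,q,s,r,t,u], ![a,b,g,c,d,h,e,f,i,j,l,k,m,n,p,o,q,r,s,t,u],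
 ![a,b,g,c,d,h,e,f,i,j,l,k,m,n,p,o,q,s,r,t,u], ![a,b,g,c,d,h,e,f,i,j,l,k,m,p,n,o,q,r,s,t,u], ![a,b,g,c,d,h,e,f,i,l,j,k,m,n,o,p,q,r,s,t,u], ![a,b,g,c,d,h,e,f,i,l,j,k,m,n,o,p,q,s,r,t,u],
 ![a,b,g,c,d,h,e,f,i,l,j,k,m,n,p,o,q,r,s,t,u], ![a,b,g,c,d,h,e,f,i,l,j,k,m,n,p,o,q,s,r,t,u], ![a,b,g,c,d,h,e,f,i,l,j,k,m,p,n,o,q,r,s,t,u], ![a,b,g,c,d,h,e,i,f,j,k,l,m,n,p,o,q,r,s,t,u] ]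
 else
 if N < 114 then
 [ -- block 113: chambers 1808…1823, four per line
 ![a,b,g,c,d,h,e,i,f,j,k,l,m,n,p,o,q,s,r,t,u], ![a,b,g,c,d,h,e,i,f,j,k,l,m,n,p,q,o,s,r,t,u], ![a,b,g,c,d,h,e,i,f,j,k,l,m,p,n,o,q,r,s,t,u], ![a,b,g,c,d,h,e,i,f,j,k,l,m,p,n,q,o,r,s,t,u],
 ![a,b,g,c,d,h,e,i,f,j,k,l,m,p,n,q,o,s,r,t,u], ![a,b,g,c,d,h,e,i,f,j,l,k,m,n,p,o,q,r,s,t,u], ![a,b,g,c,d,h,e,i,f,j,l,k,m,n,p,o,q,s,r,t,u], ![a,b,g,c,d,h,e,i,f,j,l,k,m,n,p,q,o,s,r,t,u],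
 ![a,b,g,c,d,h,e,i,f,j,l,k,m,p,n,o,q,r,s,t,u], ![a,b,g,c,d,h,e,i,f,j,l,k,m,p,n,q,o,r,s,t,u], ![a,b,g,c,d,h,e,i,f,j,l,k,m,p,n,q,o,s,r,t,u], ![a,b,g,c,d,h,e,i,f,j,l,m,k,n,p,q,o,s,r,t,u],
 ![a,b,g,c,d,h,e,i,f,j,l,m,k,p,n,q,o,r,s,t,u], ![a,b,g,c,d,h,e,i,f,j,l,m,k,p,n,q,o,s,r,t,u], ![a,b,g,c,d,h,e,i,f,j,l,m,p,k,n,q,o,r,s,t,u], ![a,b,g,c,d,h,e,i,f,j,l,m,p,k,n,q,o,s,r,t,u] ]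
 else
 if N < 115 then
 [ -- block 114: chambers 1824…1839, four per line
 ![a,b,g,c,d,h,e,i,f,l,j,k,m,n,p,o,q,r,s,t,u], ![a,b,g,c,d,h,e,i,f,l,j,k,m,n,p,o,q,s,r,t,u], ![a,b,g,c,d,h,e,i,f,l,j,k,m,p,n,o,q,r,s,t,u], ![a,b,g,c,d,h,e,i,f,l,j,m,k,n,p,o,q,r,s,t,u],
 ![a,b,g,c,d,h,e,i,f,l,j,m,k,n,p,o,q,s,r,t,u], ![a,b,g,c,d,h,e,i,f,l,j,m,k,n,p,q,o,s,r,t,u], ![a,b,g,c,d,h,e,i,f,l,j,m,k,p,n,o,q,r,s,t,u], ![a,b,g,c,d,h,e,i,f,l,j,m,k,p,n,q,o,r,s,t,u],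
 ![a,b,g,c,d,h,e,i,f,l,j,m,k,p,n,q,o,s,r,t,u], ![a,b,g,c,d,h,e,i,f,l,j,m,p,k,n,q,o,r,s,t,u], ![a,b,g,c,d,h,e,i,f,l,j,m,p,k,n,q,o,s,r,t,u], ![a,b,g,c,d,h,e,i,j,f,k,l,m,n,p,q,o,s,r,t,u],
 ![a,b,g,c,d,h,e,i,j,f,k,l,m,n,p,q,s,o,r,t,u], ![a,b,g,c,d,h,e,i,j,f,k,l,m,p,n,q,o,s,r,t,u], ![a,b,g,c,d,h,e,i,j,f,k,l,m,p,n,q,s,o,r,t,u], ![a,b,g,c,d,h,e,i,j,f,l,k,m,n,p,q,o,s,r,t,u] ]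
 else
 [ -- block 115: chambers 1840…1855, four per line
 ![a,b,g,c,d,h,e,i,j,f,l,k,m,n,p,q,s,o,r,t,u], ![a,b,g,c,d,h,e,i,j,f,l,k,m,p,n,q,o,s,r,t,u], ![a,b,g,c,d,h,e,i,j,f,l,k,m,p,n,q,s,o,r,t,u], ![a,b,g,c,d,h,e,i,j,f,l,m,k,n,p,q,o,s,r,t,u],
 ![a,b,g,c,d,h,e,i,j,f,l,m,k,n,p,q,s,o,r,t,u], ![a,b,g,c,d,h,e,i,j,f,l,m,k,p,n,q,o,s,r,t,u], ![a,b,g,c,d,h,e,i,j,f,l,m,k,p,n,q,s,o,r,t,u], ![a,b,g,c,d,h,e,i,j,f,l,m,p,k,n,q,o,s,r,t,u],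
 ![a,b,g,c,d,h,e,i,j,f,l,m,p,k,n,q,s,o,r,t,u], ![a,b,g,c,d,h,e,i,j,l,f,m,k,n,p,q,o,s,r,t,u], ![a,b,g,c,d,h,e,i,j,l,f,m,k,n,p,q,s,o,r,t,u], ![a,b,g,c,d,h,e,i,j,l,f,m,k,p,n,q,o,s,r,t,u],
 ![a,b,g,c,d,h,e,i,j,l,f,m,k,p,n,q,s,o,r,t,u], ![a,b,g,c,d,h,e,i,j,l,f,m,n,k,p,q,s,o,r,t,u], ![a,b,g,c,d,h,e,i,j,l,f,m,n,p,k,q,s,o,r,t,u], ![a,b,g,c,d,h,e,i,j,l,f,m,p,k,n,q,o,s,r,t,u] ]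
 else
 if N < 119 then
 if N < 117 then
 [ -- block 116: chambers 1856…1871, four per line
 ![a,b,g,c,d,h,e,i,j,l,f,m,p,k,n,q,s,o,r,t,u], ![a,b,g,c,d,h,e,i,j,l,f,m,p,n,k,q,s,o,r,t,u], ![a,b,g,c,d,h,e,i,j,l,m,f,n,p,k,q,s,o,r,t,u], ![a,b,g,c,d,h,e,i,j,l,m,f,n,p,q,k,s,o,r,t,u],
 ![a,b,g,c,d,h,e,i,j,l,m,f,p,n,k,q,s,o,r,t,u], ![a,b,g,c,d,h,e,i,j,l,m,f,p,n,q,k,s,o,r,t,u], ![a,b,g,c,d,h,e,i,j,l,m,n,f,p,q,k,s,o,r,t,u], ![a,b,g,c,d,h,e,i,j,l,m,n,f,p,q,s,k,o,r,t,u],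
 ![a,b,g,c,d,h,e,i,j,l,m,n,p,f,q,k,s,o,r,t,u], ![a,b,g,c,d,h,e,i,j,l,m,n,p,f,q,s,k,o,r,t,u], ![a,b,g,c,d,h,e,i,j,l,m,n,p,q,f,s,k,o,r,t,u], ![a,b,g,c,d,h,e,i,j,l,m,n,p,q,s,f,k,o,r,t,u],
 ![a,b,g,c,d,h,e,i,j,l,m,p,f,n,q,k,s,o,r,t,u], ![a,b,g,c,d,h,e,i,j,l,m,p,n,f,q,k,s,o,r,t,u], ![a,b,g,c,d,h,e,i,j,l,m,p,n,f,q,s,k,o,r,t,u], ![a,b,g,c,d,h,e,i,j,l,m,p,n,q,f,s,k,o,r,t,u] ]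
 else
 if N < 118 then
 [ -- block 117: chambers 1872…1887, four per line
 ![a,b,g,c,d,h,e,i,j,l,m,p,n,q,s,f,k,o,r,t,u], ![a,b,g,c,d,h,e,i,l,f,j,m,k,n,p,o,q,r,s,t,u], ![a,b,g,c,d,h,e,i,l,f,j,m,k,n,p,o,q,s,r,t,u], ![a,b,g,c,d,h,e,i,l,f,j,m,k,n,p,q,o,s,r,t,u],
 ![a,b,g,c,d,h,e,i,l,f,j,m,k,p,n,o,q,r,s,t,u], ![a,b,g,c,d,h,e,i,l,f,j,m,k,p,n,q,o,r,s,t,u], ![a,b,g,c,d,h,e,i,l,f,j,m,k,p,n,q,o,s,r,t,u], ![a,b,g,c,d,h,e,i,l,f,j,m,p,k,n,q,o,r,s,t,u],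
 ![a,b,g,c,d,h,e,i,l,f,j,m,p,k,n,q,o,s,r,t,u], ![a,b,g,c,d,h,e,i,l,j,f,m,k,n,p,q,o,s,r,t,u], ![a,b,g,c,d,h,e,i,l,j,f,m,k,p,n,q,o,s,r,t,u], ![a,b,g,c,d,h,e,i,l,j,f,m,n,k,p,q,o,s,r,t,u],
 ![a,b,g,c,d,h,e,i,l,j,f,m,n,k,p,q,s,o,r,t,u], ![a,b,g,c,d,h,e,i,l,j,f,m,n,p,k,q,o,s,r,t,u], ![a,b,g,c,d,h,e,i,l,j,f,m,n,p,k,q,s,o,r,t,u], ![a,b,g,c,d,h,e,i,l,j,f,m,p,k,n,q,o,s,r,t,u] ]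
 else
 [ -- block 118: chambers 1888…1903, four per line
 ![a,b,g,c,d,h,e,i,l,j,f,m,p,n,k,q,o,s,r,t,u], ![a,b,g,c,d,h,e,i,l,j,f,m,p,n,k,q,s,o,r,t,u], ![a,b,g,c,d,h,e,i,l,j,m,f,n,p,k,q,o,s,r,t,u], ![a,b,g,c,d,h,e,i,l,j,m,f,n,p,k,q,s,o,r,t,u],
 ![a,b,g,c,d,h,e,i,l,j,m,f,n,p,q,k,s,o,r,t,u], ![a,b,g,c,d,h,e,i,l,j,m,f,p,n,k,q,o,s,r,t,u], ![a,b,g,c,d,h,e,i,l,j,m,f,p,n,k,q,s,o,r,t,u], ![a,b,g,c,d,h,e,i,l,j,m,f,p,n,q,k,s,o,r,t,u],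
 ![a,b,g,c,d,h,e,i,l,j,m,n,f,p,q,k,s,o,r,t,u], ![a,b,g,c,d,h,e,i,l,j,m,n,f,p,q,s,k,o,r,t,u], ![a,b,g,c,d,h,e,i,l,j,m,n,p,f,q,k,s,o,r,t,u], ![a,b,g,c,d,h,e,i,l,j,m,n,p,f,q,s,k,o,r,t,u],
 ![a,b,g,c,d,h,e,i,l,j,m,n,p,q,f,s,k,o,r,t,u], ![a,b,g,c,d,h,e,i,l,j,m,n,p,q,s,f,k,o,r,t,u], ![a,b,g,c,d,h,e,i,l,j,m,p,f,n,q,k,s,o,r,t,u], ![a,b,g,c,d,h,e,i,l,j,m,p,n,f,q,k,s,o,r,t,u] ]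
 else
 if N < 120 then
 [ -- block 119: chambers 1904…1919, four per line
 ![a,b,g,c,d,h,e,i,l,j,m,p,n,f,q,s,k,o,r,t,u], ![a,b,g,c,d,h,e,i,l,j,m,p,n,q,f,s,k,o,r,t,u], ![a,b,g,c,d,h,e,i,l,j,m,p,n,q,s,f,k,o,r,t,u], ![a,b,g,c,d,h,i,e,f,j,k,l,m,p,n,o,q,r,s,t,u],
 ![a,b,g,c,d,h,i,e,f,j,k,l,m,p,n,q,o,r,s,t,u], ![a,b,g,c,d,h,i,e,f,j,l,k,m,p,n,o,q,r,s,t,u], ![a,b,g,c,d,h,i,e,f,j,l,k,m,p,n,q,o,r,s,t,u], ![a,b,g,c,d,h,i,e,f,j,l,m,k,p,n,q,o,r,s,t,u],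
 ![a,b,g,c,d,h,i,e,f,j,l,m,p,k,n,q,o,r,s,t,u], ![a,b,g,c,d,h,i,e,f,l,j,k,m,p,n,o,q,r,s,t,u], ![a,b,g,c,d,h,i,e,f,l,j,m,k,p,n,o,q,r,s,t,u], ![a,b,g,c,d,h,i,e,f,l,j,m,k,p,n,q,o,r,s,t,u],
 ![a,b,g,c,d,h,i,e,f,l,j,m,p,k,n,q,o,r,s,t,u], ![a,b,g,c,d,h,i,e,f,l,m,j,k,p,n,o,q,r,s,t,u], ![a,b,g,c,d,h,i,e,f,l,m,j,p,k,n,o,q,r,s,t,u], ![a,b,g,c,d,h,i,e,f,l,m,j,p,k,n,q,o,r,s,t,u] ]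
 else
 if N < 121 then
 [ -- block 120: chambers 1920…1935, four per line
 ![a,b,g,c,d,h,i,e,f,l,m,p,j,k,n,o,q,r,s,t,u], ![a,b,g,c,d,h,i,e,f,l,m,p,j,k,n,q,o,r,s,t,u], ![a,b,g,c,d,h,i,e,j,f,k,l,m,p,n,q,o,r,s,t,u], ![a,b,g,c,d,h,i,e,j,f,k,l,m,p,n,q,o,s,r,t,u],
 ![a,b,g,c,d,h,i,e,j,f,k,l,m,p,n,q,s,o,r,t,u], ![a,b,g,c,d,h,i,e,j,f,l,k,m,p,n,q,o,r,s,t,u], ![a,b,g,c,d,h,i,e,j,f,l,k,m,p,n,q,o,s,r,t,u], ![a,b,g,c,d,h,i,e,j,f,l,k,m,p,n,q,s,o,r,t,u],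
 ![a,b,g,c,d,h,i,e,j,f,l,m,k,p,n,q,o,r,s,t,u], ![a,b,g,c,d,h,i,e,j,f,l,m,k,p,n,q,o,s,r,t,u], ![a,b,g,c,d,h,i,e,j,f,l,m,k,p,n,q,s,o,r,t,u], ![a,b,g,c,d,h,i,e,j,f,l,m,p,k,n,q,o,r,s,t,u],
 ![a,b,g,c,d,h,i,e,j,f,l,m,p,k,n,q,o,s,r,t,u], ![a,b,g,c,d,h,i,e,j,f,l,m,p,k,n,q,s,o,r,t,u], ![a,b,g,c,d,h,i,e,j,l,f,m,k,p,n,q,o,r,s,t,u], ![a,b,g,c,d,h,i,e,j,l,f,m,k,p,n,q,o,s,r,t,u] ]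
 else
 [ -- block 121: chambers 1936…1951, four per line
 ![a,b,g,c,d,h,i,e,j,l,f,m,k,p,n,q,s,o,r,t,u], ![a,b,g,c,d,h,i,e,j,l,f,m,p,k,n,q,o,r,s,t,u], ![a,b,g,c,d,h,i,e,j,l,f,m,p,k,n,q,o,s,r,t,u], ![a,b,g,c,d,h,i,e,j,l,f,m,p,k,n,q,s,o,r,t,u],
 ![a,b,g,c,d,h,i,e,j,l,m,f,p,k,n,q,o,r,s,t,u], ![a,b,g,c,d,h,i,e,j,l,m,f,p,k,n,q,o,s,r,t,u], ![a,b,g,c,d,h,i,e,j,l,m,f,p,k,n,q,s,o,r,t,u], ![a,b,g,c,d,h,i,e,j,l,m,f,p,n,k,q,s,o,r,t,u],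
 ![a,b,g,c,d,h,i,e,j,l,m,p,f,k,n,q,o,r,s,t,u], ![a,b,g,c,d,h,i,e,j,l,m,p,f,k,n,q,o,s,r,t,u], ![a,b,g,c,d,h,i,e,j,l,m,p,f,k,n,q,s,o,r,t,u], ![a,b,g,c,d,h,i,e,j,l,m,p,f,n,k,q,s,o,r,t,u],
 ![a,b,g,c,d,h,i,e,j,l,m,p,f,n,q,k,s,o,r,t,u], ![a,b,g,c,d,h,i,e,j,l,m,p,n,f,q,k,s,o,r,t,u], ![a,b,g,c,d,h,i,e,j,l,m,p,n,q,f,k,s,o,r,t,u], ![a,b,g,c,d,h,i,e,j,l,m,p,n,q,f,s,k,o,r,t,u] ]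
 else
 if N < 142 then
 if N < 132 then
 if N < 127 then
 if N < 124 then
 if N < 123 then
 [ -- block 122: chambers 1952…1967, four per line
 ![a,b,g,c,d,h,i,e,j,l,m,p,n,q,s,f,k,o,r,t,u], ![a,b,g,c,d,h,i,e,l,f,j,m,k,p,n,o,q,r,s,t,u], ![a,b,g,c,d,h,i,e,l,f,j,m,k,p,n,q,o,r,s,t,u], ![a,b,g,c,d,h,i,e,l,f,j,m,p,k,n,q,o,r,s,t,u],
 ![a,b,g,c,d,h,i,e,l,f,m,j,k,p,n,o,q,r,s,t,u], ![a,b,g,c,d,h,i,e,l,f,m,j,p,k,n,o,q,r,s,t,u], ![a,b,g,c,d,h,i,e,l,f,m,j,p,k,n,q,o,r,s,t,u], ![a,b,g,c,d,h,i,e,l,f,m,p,j,k,n,o,q,r,s,t,u],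
 ![a,b,g,c,d,h,i,e,l,f,m,p,j,k,n,q,o,r,s,t,u], ![a,b,g,c,d,h,i,e,l,j,f,m,k,p,n,q,o,r,s,t,u], ![a,b,g,c,d,h,i,e,l,j,f,m,k,p,n,q,o,s,r,t,u], ![a,b,g,c,d,h,i,e,l,j,f,m,p,k,n,q,o,r,s,t,u],
 ![a,b,g,c,d,h,i,e,l,j,f,m,p,k,n,q,o,s,r,t,u], ![a,b,g,c,d,h,i,e,l,j,m,f,p,k,n,q,o,r,s,t,u], ![a,b,g,c,d,h,i,e,l,j,m,f,p,k,n,q,o,s,r,t,u], ![a,b,g,c,d,h,i,e,l,j,m,f,p,n,k,q,o,s,r,t,u] ]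
 else
 [ -- block 123: chambers 1968…1983, four per line
 ![a,b,g,c,d,h,i,e,l,j,m,f,p,n,k,q,s,o,r,t,u], ![a,b,g,c,d,h,i,e,l,j,m,p,f,k,n,q,o,r,s,t,u], ![a,b,g,c,d,h,i,e,l,j,m,p,f,k,n,q,o,s,r,t,u], ![a,b,g,c,d,h,i,e,l,j,m,p,f,n,k,q,o,s,r,t,u],
 ![a,b,g,c,d,h,i,e,l,j,m,p,f,n,k,q,s,o,r,t,u], ![a,b,g,c,d,h,i,e,l,j,m,p,f,n,q,k,s,o,r,t,u], ![a,b,g,c,d,h,i,e,l,j,m,p,n,f,q,k,s,o,r,t,u], ![a,b,g,c,d,h,i,e,l,j,m,p,n,q,f,k,s,o,r,t,u],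
 ![a,b,g,c,d,h,i,e,l,j,m,p,n,q,f,s,k,o,r,t,u], ![a,b,g,c,d,h,i,e,l,j,m,p,n,q,s,f,k,o,r,t,u], ![a,b,g,c,d,h,i,e,l,m,f,j,p,k,n,q,o,r,s,t,u], ![a,b,g,c,d,h,i,e,l,m,f,p,j,k,n,q,o,r,s,t,u],
 ![a,b,g,c,d,h,i,e,l,m,j,f,p,k,n,q,o,r,s,t,u], ![a,b,g,c,d,h,i,e,l,m,j,f,p,n,k,q,o,r,s,t,u], ![a,b,g,c,d,h,i,e,l,m,j,f,p,n,k,q,o,s,r,t,u], ![a,b,g,c,d,h,i,e,l,m,j,p,f,k,n,q,o,r,s,t,u] ]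
 else
 if N < 125 then
 [ -- block 124: chambers 1984…1999, four per line
 ![a,b,g,c,d,h,i,e,l,m,j,p,f,n,k,q,o,r,s,t,u], ![a,b,g,c,d,h,i,e,l,m,j,p,f,n,k,q,o,s,r,t,u], ![a,b,g,c,d,h,i,e,l,m,j,p,f,n,q,k,o,s,r,t,u], ![a,b,g,c,d,h,i,e,l,m,j,p,f,n,q,k,s,o,r,t,u],
 ![a,b,g,c,d,h,i,e,l,m,j,p,n,f,q,k,s,o,r,t,u], ![a,b,g,c,d,h,i,e,l,m,j,p,n,q,f,k,s,o,r,t,u], ![a,b,g,c,d,h,i,e,l,m,j,p,n,q,f,s,k,o,r,t,u], ![a,b,g,c,d,h,i,e,l,m,j,p,n,q,s,f,k,o,r,t,u],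
 ![a,b,g,c,d,h,i,e,l,m,p,f,j,k,n,q,o,r,s,t,u], ![a,b,g,c,d,h,i,e,l,m,p,j,f,k,n,q,o,r,s,t,u], ![a,b,g,c,d,h,i,e,l,m,p,j,f,n,k,q,o,r,s,t,u], ![a,b,g,c,d,h,i,e,l,m,p,j,f,n,q,k,o,r,s,t,u],
 ![a,b,g,c,d,h,i,e,l,m,p,j,f,n,q,k,o,s,r,t,u], ![a,b,g,c,d,h,i,e,l,m,p,j,f,n,q,k,s,o,r,t,u], ![a,b,g,c,d,h,i,e,l,m,p,j,n,f,q,k,s,o,r,t,u], ![a,b,g,c,d,h,i,e,l,m,p,j,n,q,f,k,s,o,r,t,u] ]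
 else
 if N < 126 then
 [ -- block 125: chambers 2000…2015, four per line
 ![a,b,g,c,d,h,i,e,l,m,p,j,n,q,f,s,k,o,r,t,u], ![a,b,g,c,d,h,i,e,l,m,p,j,n,q,s,f,k,o,r,t,u], ![a,b,g,c,d,h,i,l,e,f,m,j,k,p,n,o,q,r,s,t,u], ![a,b,g,c,d,h,i,l,e,f,m,j,p,k,n,o,q,r,s,t,u],
 ![a,b,g,c,d,h,i,l,e,f,m,p,j,k,n,o,q,r,s,t,u], ![a,b,g,c,d,h,i,l,e,m,f,j,p,k,n,o,q,r,s,t,u], ![a,b,g,c,d,h,i,l,e,m,f,j,p,k,n,q,o,r,s,t,u], ![a,b,g,c,d,h,i,l,e,m,f,p,j,k,n,o,q,r,s,t,u],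
 ![a,b,g,c,d,h,i,l,e,m,f,p,j,k,n,q,o,r,s,t,u], ![a,b,g,c,d,h,i,l,e,m,j,f,p,k,n,q,o,r,s,t,u], ![a,b,g,c,d,h,i,l,e,m,j,f,p,n,k,q,o,r,s,t,u], ![a,b,g,c,d,h,i,l,e,m,j,f,p,n,k,q,o,s,r,t,u],
 ![a,b,g,c,d,h,i,l,e,m,j,p,f,k,n,q,o,r,s,t,u], ![a,b,g,c,d,h,i,l,e,m,j,p,f,n,k,q,o,r,s,t,u], ![a,b,g,c,d,h,i,l,e,m,j,p,f,n,k,q,o,s,r,t,u], ![a,b,g,c,d,h,i,l,e,m,j,p,f,n,q,k,o,s,r,t,u] ]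
 else
 [ -- block 126: chambers 2016…2031, four per line
 ![a,b,g,c,d,h,i,l,e,m,j,p,n,f,q,k,o,s,r,t,u], ![a,b,g,c,d,h,i,l,e,m,j,p,n,f,q,k,s,o,r,t,u], ![a,b,g,c,d,h,i,l,e,m,j,p,n,q,f,k,s,o,r,t,u], ![a,b,g,c,d,h,i,l,e,m,j,p,n,q,f,s,k,o,r,t,u],
 ![a,b,g,c,d,h,i,l,e,m,j,p,n,q,s,f,k,o,r,t,u], ![a,b,g,c,d,h,i,l,e,m,p,f,j,k,n,q,o,r,s,t,u], ![a,b,g,c,d,h,i,l,e,m,p,j,f,k,n,q,o,r,s,t,u], ![a,b,g,c,d,h,i,l,e,m,p,j,f,n,k,q,o,r,s,t,u],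
 ![a,b,g,c,d,h,i,l,e,m,p,j,f,n,q,k,o,r,s,t,u], ![a,b,g,c,d,h,i,l,e,m,p,j,f,n,q,k,o,s,r,t,u], ![a,b,g,c,d,h,i,l,e,m,p,j,n,f,q,k,o,s,r,t,u], ![a,b,g,c,d,h,i,l,e,m,p,j,n,f,q,k,s,o,r,t,u],
 ![a,b,g,c,d,h,i,l,e,m,p,j,n,q,f,k,s,o,r,t,u], ![a,b,g,c,d,h,i,l,e,m,p,j,n,q,f,s,k,o,r,t,u], ![a,b,g,c,d,h,i,l,e,m,p,j,n,q,s,f,k,o,r,t,u], ![a,b,g,c,d,h,i,l,m,e,f,p,j,k,n,o,q,r,s,t,u] ]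
 else
 if N < 129 then
 if N < 128 then
 [ -- block 127: chambers 2032…2047, four per line
 ![a,b,g,c,d,h,i,l,m,e,p,f,j,k,n,o,q,r,s,t,u], ![a,b,g,c,d,h,i,l,m,e,p,f,j,k,n,q,o,r,s,t,u], ![a,b,g,c,d,h,i,l,m,e,p,j,f,k,n,q,o,r,s,t,u], ![a,b,g,c,d,h,i,l,m,e,p,j,f,n,k,q,o,r,s,t,u],
 ![a,b,g,c,d,h,i,l,m,e,p,j,f,n,q,k,o,r,s,t,u], ![a,b,g,c,d,h,i,l,m,e,p,j,n,f,q,k,o,r,s,t,u], ![a,b,g,c,d,h,i,l,m,e,p,j,n,f,q,k,o,s,r,t,u], ![a,b,g,c,d,h,i,l,m,e,p,j,n,q,f,k,o,s,r,t,u],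
 ![a,b,g,c,d,h,i,l,m,e,p,j,n,q,f,k,s,o,r,t,u], ![a,b,g,c,d,h,i,l,m,e,p,j,n,q,f,s,k,o,r,t,u], ![a,b,g,c,d,h,i,l,m,e,p,j,n,q,s,f,k,o,r,t,u], ![a,b,g,c,d,h,i,l,m,p,e,f,j,k,n,o,q,r,s,t,u],
 ![a,b,g,c,d,h,i,l,m,p,e,f,j,k,n,q,o,r,s,t,u], ![a,b,g,c,d,h,i,l,m,p,e,j,f,k,n,q,o,r,s,t,u], ![a,b,g,c,d,h,i,l,m,p,e,j,f,n,k,q,o,r,s,t,u], ![a,b,g,c,d,h,i,l,m,p,e,j,f,n,q,k,o,r,s,t,u] ]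
 else
 [ -- block 128: chambers 2048…2063, four per line
 ![a,b,g,c,d,h,i,l,m,p,e,j,n,f,q,k,o,r,s,t,u], ![a,b,g,c,d,h,i,l,m,p,e,j,n,q,f,k,o,r,s,t,u], ![a,b,g,c,d,h,i,l,m,p,e,j,n,q,f,k,o,s,r,t,u], ![a,b,g,c,d,h,i,l,m,p,e,j,n,q,f,k,s,o,r,t,u],
 ![a,b,g,c,d,h,i,l,m,p,e,j,n,q,f,s,k,o,r,t,u], ![a,b,g,c,d,h,i,l,m,p,e,j,n,q,s,f,k,o,r,t,u], ![a,b,g,c,h,d,e,f,i,j,k,l,m,n,o,p,q,r,s,t,u], ![a,b,g,c,h,d,e,f,i,j,k,l,m,n,o,p,q,s,r,t,u],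
 ![a,b,g,c,h,d,e,f,i,j,l,k,m,n,o,p,q,r,s,t,u], ![a,b,g,c,h,d,e,f,i,j,l,k,m,n,o,p,q,s,r,t,u], ![a,b,g,c,h,d,e,f,i,l,j,k,m,n,o,p,q,r,s,t,u], ![a,b,g,c,h,d,e,f,i,l,j,k,m,n,o,p,q,s,r,t,u],
 ![a,b,g,c,h,d,e,f,l,i,j,k,m,n,o,p,q,r,s,t,u], ![a,b,g,c,h,d,e,f,l,i,j,k,m,n,o,p,q,s,r,t,u], ![a,b,g,c,h,d,e,i,f,j,k,l,m,n,o,p,q,r,s,t,u], ![a,b,g,c,h,d,e,i,f,j,k,l,m,n,o,p,q,s,r,t,u] ]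
 else
 if N < 130 then
 [ -- block 129: chambers 2064…2079, four per line
 ![a,b,g,c,h,d,e,i,f,j,k,l,m,n,p,o,q,r,s,t,u], ![a,b,g,c,h,d,e,i,f,j,k,l,m,n,p,o,q,s,r,t,u], ![a,b,g,c,h,d,e,i,f,j,l,k,m,n,o,p,q,r,s,t,u], ![a,b,g,c,h,d,e,i,f,j,l,k,m,n,o,p,q,s,r,t,u],
 ![a,b,g,c,h,d,e,i,f,j,l,k,m,n,p,o,q,r,s,t,u], ![a,b,g,c,h,d,e,i,f,j,l,k,m,n,p,o,q,s,r,t,u], ![a,b,g,c,h,d,e,i,f,l,j,k,m,n,o,p,q,r,s,t,u], ![a,b,g,c,h,d,e,i,f,l,j,k,m,n,o,p,q,s,r,t,u],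
 ![a,b,g,c,h,d,e,i,f,l,j,k,m,n,p,o,q,r,s,t,u], ![a,b,g,c,h,d,e,i,f,l,j,k,m,n,p,o,q,s,r,t,u], ![a,b,g,c,h,d,e,i,j,f,k,l,m,n,o,p,q,s,r,t,u], ![a,b,g,c,h,d,e,i,j,f,k,l,m,n,p,o,q,s,r,t,u],
 ![a,b,g,c,h,d,e,i,j,f,k,l,m,n,p,q,o,s,r,t,u], ![a,b,g,c,h,d,e,i,j,f,k,l,m,n,p,q,s,o,r,t,u], ![a,b,g,c,h,d,e,i,j,f,l,k,m,n,o,p,q,s,r,t,u], ![a,b,g,c,h,d,e,i,j,f,l,k,m,n,p,o,q,s,r,t,u] ]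
 else
 if N < 131 then
 [ -- block 130: chambers 2080…2095, four per line
 ![a,b,g,c,h,d,e,i,j,f,l,k,m,n,p,q,o,s,r,t,u], ![a,b,g,c,h,d,e,i,j,f,l,k,m,n,p,q,s,o,r,t,u], ![a,b,g,c,h,d,e,i,j,l,f,k,m,n,o,p,q,s,r,t,u], ![a,b,g,c,h,d,e,i,j,l,f,k,m,n,p,o,q,s,r,t,u],
 ![a,b,g,c,h,d,e,i,j,l,f,k,m,n,p,q,o,s,r,t,u], ![a,b,g,c,h,d,e,i,j,l,f,k,m,n,p,q,s,o,r,t,u], ![a,b,g,c,h,d,e,i,j,l,f,m,k,n,p,q,o,s,r,t,u], ![a,b,g,c,h,d,e,i,j,l,f,m,k,n,p,q,s,o,r,t,u],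
 ![a,b,g,c,h,d,e,i,j,l,f,m,n,k,p,q,s,o,r,t,u], ![a,b,g,c,h,d,e,i,j,l,m,f,n,k,p,q,s,o,r,t,u], ![a,b,g,c,h,d,e,i,j,l,m,f,n,p,k,q,s,o,r,t,u], ![a,b,g,c,h,d,e,i,j,l,m,n,f,k,p,q,s,o,r,t,u],
 ![a,b,g,c,h,d,e,i,j,l,m,n,f,p,k,q,s,o,r,t,u], ![a,b,g,c,h,d,e,i,j,l,m,n,f,p,q,k,s,o,r,t,u], ![a,b,g,c,h,d,e,i,j,l,m,n,f,p,q,s,k,o,r,t,u], ![a,b,g,c,h,d,e,i,j,l,m,n,p,f,q,k,s,o,r,t,u] ]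
 else
 [ -- block 131: chambers 2096…2111, four per line
 ![a,b,g,c,h,d,e,i,j,l,m,n,p,f,q,s,k,o,r,t,u], ![a,b,g,c,h,d,e,i,j,l,m,n,p,q,f,s,k,o,r,t,u], ![a,b,g,c,h,d,e,i,j,l,m,n,p,q,s,f,k,o,r,t,u], ![a,b,g,c,h,d,e,i,l,f,j,k,m,n,o,p,q,r,s,t,u],
 ![a,b,g,c,h,d,e,i,l,f,j,k,m,n,o,p,q,s,r,t,u], ![a,b,g,c,h,d,e,i,l,f,j,k,m,n,p,o,q,r,s,t,u], ![a,b,g,c,h,d,e,i,l,f,j,k,m,n,p,o,q,s,r,t,u], ![a,b,g,c,h,d,e,i,l,f,j,m,k,n,p,o,q,r,s,t,u],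
 ![a,b,g,c,h,d,e,i,l,f,j,m,k,n,p,o,q,s,r,t,u], ![a,b,g,c,h,d,e,i,l,j,f,k,m,n,o,p,q,s,r,t,u], ![a,b,g,c,h,d,e,i,l,j,f,k,m,n,p,o,q,s,r,t,u], ![a,b,g,c,h,d,e,i,l,j,f,m,k,n,p,o,q,s,r,t,u],
 ![a,b,g,c,h,d,e,i,l,j,f,m,k,n,p,q,o,s,r,t,u], ![a,b,g,c,h,d,e,i,l,j,f,m,n,k,p,q,o,s,r,t,u], ![a,b,g,c,h,d,e,i,l,j,f,m,n,k,p,q,s,o,r,t,u], ![a,b,g,c,h,d,e,i,l,j,m,f,n,k,p,q,o,s,r,t,u] ]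
 else
 if N < 137 then
 if N < 134 then
 if N < 133 then
 [ -- block 132: chambers 2112…2127, four per line
 ![a,b,g,c,h,d,e,i,l,j,m,f,n,k,p,q,s,o,r,t,u], ![a,b,g,c,h,d,e,i,l,j,m,f,n,p,k,q,o,s,r,t,u], ![a,b,g,c,h,d,e,i,l,j,m,f,n,p,k,q,s,o,r,t,u], ![a,b,g,c,h,d,e,i,l,j,m,n,f,k,p,q,s,o,r,t,u],
 ![a,b,g,c,h,d,e,i,l,j,m,n,f,p,k,q,s,o,r,t,u], ![a,b,g,c,h,d,e,i,l,j,m,n,f,p,q,k,s,o,r,t,u], ![a,b,g,c,h,d,e,i,l,j,m,n,f,p,q,s,k,o,r,t,u], ![a,b,g,c,h,d,e,i,l,j,m,n,p,f,q,k,s,o,r,t,u],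
 ![a,b,g,c,h,d,e,i,l,j,m,n,p,f,q,s,k,o,r,t,u], ![a,b,g,c,h,d,e,i,l,j,m,n,p,q,f,s,k,o,r,t,u], ![a,b,g,c,h,d,e,i,l,j,m,n,p,q,s,f,k,o,r,t,u], ![a,b,g,c,h,d,e,l,f,i,j,k,m,n,o,p,q,r,s,t,u],
 ![a,b,g,c,h,d,e,l,f,i,j,k,m,n,o,p,q,s,r,t,u], ![a,b,g,c,h,d,e,l,i,f,j,k,m,n,o,p,q,r,s,t,u], ![a,b,g,c,h,d,e,l,i,f,j,k,m,n,o,p,q,s,r,t,u], ![a,b,g,c,h,d,e,l,i,f,j,m,k,n,o,p,q,r,s,t,u] ]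
 else
 [ -- block 133: chambers 2128…2143, four per line
 ![a,b,g,c,h,d,e,l,i,f,j,m,k,n,o,p,q,s,r,t,u], ![a,b,g,c,h,d,e,l,i,f,j,m,k,n,p,o,q,r,s,t,u], ![a,b,g,c,h,d,e,l,i,f,j,m,k,n,p,o,q,s,r,t,u], ![a,b,g,c,h,d,e,l,i,j,f,k,m,n,o,p,q,s,r,t,u],
 ![a,b,g,c,h,d,e,l,i,j,f,m,k,n,o,p,q,s,r,t,u], ![a,b,g,c,h,d,e,l,i,j,f,m,k,n,p,o,q,s,r,t,u], ![a,b,g,c,h,d,e,l,i,j,f,m,n,k,o,p,q,s,r,t,u], ![a,b,g,c,h,d,e,l,i,j,f,m,n,k,p,o,q,s,r,t,u],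
 ![a,b,g,c,h,d,e,l,i,j,f,m,n,k,p,q,o,s,r,t,u], ![a,b,g,c,h,d,e,l,i,j,f,m,n,k,p,q,s,o,r,t,u], ![a,b,g,c,h,d,e,l,i,j,m,f,n,k,p,q,o,s,r,t,u], ![a,b,g,c,h,d,e,l,i,j,m,f,n,k,p,q,s,o,r,t,u],
 ![a,b,g,c,h,d,e,l,i,j,m,f,n,p,k,q,o,s,r,t,u], ![a,b,g,c,h,d,e,l,i,j,m,f,n,p,k,q,s,o,r,t,u], ![a,b,g,c,h,d,e,l,i,j,m,n,f,k,p,q,s,o,r,t,u], ![a,b,g,c,h,d,e,l,i,j,m,n,f,p,k,q,s,o,r,t,u] ]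
 else
 if N < 135 then
 [ -- block 134: chambers 2144…2159, four per line
 ![a,b,g,c,h,d,e,l,i,j,m,n,f,p,q,k,s,o,r,t,u], ![a,b,g,c,h,d,e,l,i,j,m,n,f,p,q,s,k,o,r,t,u], ![a,b,g,c,h,d,e,l,i,j,m,n,p,f,q,k,s,o,r,t,u], ![a,b,g,c,h,d,e,l,i,j,m,n,p,f,q,s,k,o,r,t,u],
 ![a,b,g,c,h,d,e,l,i,j,m,n,p,q,f,s,k,o,r,t,u], ![a,b,g,c,h,d,e,l,i,j,m,n,p,q,s,f,k,o,r,t,u], ![a,b,g,c,h,d,i,e,f,j,k,l,m,n,o,p,q,r,s,t,u], ![a,b,g,c,h,d,i,e,f,j,k,l,m,n,p,o,q,r,s,t,u],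
 ![a,b,g,c,h,d,i,e,f,j,k,l,m,p,n,o,q,r,s,t,u], ![a,b,g,c,h,d,i,e,f,j,l,k,m,n,o,p,q,r,s,t,u], ![a,b,g,c,h,d,i,e,f,j,l,k,m,n,p,o,q,r,s,t,u], ![a,b,g,c,h,d,i,e,f,j,l,k,m,p,n,o,q,r,s,t,u],
 ![a,b,g,c,h,d,i,e,f,l,j,k,m,n,o,p,q,r,s,t,u], ![a,b,g,c,h,d,i,e,f,l,j,k,m,n,p,o,q,r,s,t,u], ![a,b,g,c,h,d,i,e,f,l,j,k,m,p,n,o,q,r,s,t,u], ![a,b,g,c,h,d,i,e,j,f,k,l,m,n,o,p,q,r,s,t,u] ]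
 else
 if N < 136 then
 [ -- block 135: chambers 2160…2175, four per line
 ![a,b,g,c,h,d,i,e,j,f,k,l,m,n,o,p,q,s,r,t,u], ![a,b,g,c,h,d,i,e,j,f,k,l,m,n,p,o,q,r,s,t,u], ![a,b,g,c,h,d,i,e,j,f,k,l,m,n,p,o,q,s,r,t,u], ![a,b,g,c,h,d,i,e,j,f,k,l,m,n,p,q,o,s,r,t,u],
 ![a,b,g,c,h,d,i,e,j,f,k,l,m,n,p,q,s,o,r,t,u], ![a,b,g,c,h,d,i,e,j,f,k,l,m,p,n,o,q,r,s,t,u], ![a,b,g,c,h,d,i,e,j,f,k,l,m,p,n,q,o,r,s,t,u], ![a,b,g,c,h,d,i,e,j,f,k,l,m,p,n,q,o,s,r,t,u],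
 ![a,b,g,c,h,d,i,e,j,f,k,l,m,p,n,q,s,o,r,t,u], ![a,b,g,c,h,d,i,e,j,f,l,k,m,n,o,p,q,r,s,t,u], ![a,b,g,c,h,d,i,e,j,f,l,k,m,n,o,p,q,s,r,t,u], ![a,b,g,c,h,d,i,e,j,f,l,k,m,n,p,o,q,r,s,t,u],
 ![a,b,g,c,h,d,i,e,j,f,l,k,m,n,p,o,q,s,r,t,u], ![a,b,g,c,h,d,i,e,j,f,l,k,m,n,p,q,o,s,r,t,u], ![a,b,g,c,h,d,i,e,j,f,l,k,m,n,p,q,s,o,r,t,u], ![a,b,g,c,h,d,i,e,j,f,l,k,m,p,n,o,q,r,s,t,u] ]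
 else
 [ -- block 136: chambers 2176…2191, four per line
 ![a,b,g,c,h,d,i,e,j,f,l,k,m,p,n,q,o,r,s,t,u], ![a,b,g,c,h,d,i,e,j,f,l,k,m,p,n,q,o,s,r,t,u], ![a,b,g,c,h,d,i,e,j,f,l,k,m,p,n,q,s,o,r,t,u], ![a,b,g,c,h,d,i,e,j,l,f,k,m,n,o,p,q,r,s,t,u],
 ![a,b,g,c,h,d,i,e,j,l,f,k,m,n,o,p,q,s,r,t,u], ![a,b,g,c,h,d,i,e,j,l,f,k,m,n,p,o,q,r,s,t,u], ![a,b,g,c,h,d,i,e,j,l,f,k,m,n,p,o,q,s,r,t,u], ![a,b,g,c,h,d,i,e,j,l,f,k,m,n,p,q,o,s,r,t,u],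
 ![a,b,g,c,h,d,i,e,j,l,f,k,m,n,p,q,s,o,r,t,u], ![a,b,g,c,h,d,i,e,j,l,f,k,m,p,n,o,q,r,s,t,u], ![a,b,g,c,h,d,i,e,j,l,f,k,m,p,n,q,o,r,s,t,u], ![a,b,g,c,h,d,i,e,j,l,f,k,m,p,n,q,o,s,r,t,u],
 ![a,b,g,c,h,d,i,e,j,l,f,k,m,p,n,q,s,o,r,t,u], ![a,b,g,c,h,d,i,e,j,l,f,m,k,n,p,q,o,s,r,t,u], ![a,b,g,c,h,d,i,e,j,l,f,m,k,n,p,q,s,o,r,t,u], ![a,b,g,c,h,d,i,e,j,l,f,m,k,p,n,q,o,r,s,t,u] ]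
 else
 if N < 139 then
 if N < 138 then
 [ -- block 137: chambers 2192…2207, four per line
 ![a,b,g,c,h,d,i,e,j,l,f,m,k,p,n,q,o,s,r,t,u], ![a,b,g,c,h,d,i,e,j,l,f,m,k,p,n,q,s,o,r,t,u], ![a,b,g,c,h,d,i,e,j,l,m,f,k,n,p,q,o,s,r,t,u], ![a,b,g,c,h,d,i,e,j,l,m,f,k,n,p,q,s,o,r,t,u],
 ![a,b,g,c,h,d,i,e,j,l,m,f,k,p,n,q,o,r,s,t,u], ![a,b,g,c,h,d,i,e,j,l,m,f,k,p,n,q,o,s,r,t,u], ![a,b,g,c,h,d,i,e,j,l,m,f,k,p,n,q,s,o,r,t,u], ![a,b,g,c,h,d,i,e,j,l,m,f,n,k,p,q,s,o,r,t,u],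
 ![a,b,g,c,h,d,i,e,j,l,m,f,n,p,k,q,s,o,r,t,u], ![a,b,g,c,h,d,i,e,j,l,m,f,p,k,n,q,o,r,s,t,u], ![a,b,g,c,h,d,i,e,j,l,m,f,p,k,n,q,o,s,r,t,u], ![a,b,g,c,h,d,i,e,j,l,m,f,p,k,n,q,s,o,r,t,u],
 ![a,b,g,c,h,d,i,e,j,l,m,f,p,n,k,q,s,o,r,t,u], ![a,b,g,c,h,d,i,e,j,l,m,n,f,k,p,q,s,o,r,t,u], ![a,b,g,c,h,d,i,e,j,l,m,n,f,p,k,q,s,o,r,t,u], ![a,b,g,c,h,d,i,e,j,l,m,n,p,f,k,q,s,o,r,t,u] ]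
 else
 [ -- block 138: chambers 2208…2223, four per line
 ![a,b,g,c,h,d,i,e,j,l,m,n,p,f,q,k,s,o,r,t,u], ![a,b,g,c,h,d,i,e,j,l,m,n,p,q,f,k,s,o,r,t,u], ![a,b,g,c,h,d,i,e,j,l,m,n,p,q,f,s,k,o,r,t,u], ![a,b,g,c,h,d,i,e,j,l,m,n,p,q,s,f,k,o,r,t,u],
 ![a,b,g,c,h,d,i,e,j,l,m,p,f,k,n,q,o,r,s,t,u], ![a,b,g,c,h,d,i,e,j,l,m,p,f,k,n,q,o,s,r,t,u], ![a,b,g,c,h,d,i,e,j,l,m,p,f,k,n,q,s,o,r,t,u], ![a,b,g,c,h,d,i,e,j,l,m,p,f,n,k,q,s,o,r,t,u],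
 ![a,b,g,c,h,d,i,e,j,l,m,p,n,f,k,q,s,o,r,t,u], ![a,b,g,c,h,d,i,e,j,l,m,p,n,f,q,k,s,o,r,t,u], ![a,b,g,c,h,d,i,e,j,l,m,p,n,q,f,k,s,o,r,t,u], ![a,b,g,c,h,d,i,e,j,l,m,p,n,q,f,s,k,o,r,t,u],
 ![a,b,g,c,h,d,i,e,j,l,m,p,n,q,s,f,k,o,r,t,u], ![a,b,g,c,h,d,i,e,l,f,j,k,m,n,o,p,q,r,s,t,u], ![a,b,g,c,h,d,i,e,l,f,j,k,m,n,p,o,q,r,s,t,u], ![a,b,g,c,h,d,i,e,l,f,j,k,m,p,n,o,q,r,s,t,u] ]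
 else
 if N < 140 then
 [ -- block 139: chambers 2224…2239, four per line
 ![a,b,g,c,h,d,i,e,l,f,j,m,k,n,p,o,q,r,s,t,u], ![a,b,g,c,h,d,i,e,l,f,j,m,k,p,n,o,q,r,s,t,u], ![a,b,g,c,h,d,i,e,l,j,f,k,m,n,o,p,q,r,s,t,u], ![a,b,g,c,h,d,i,e,l,j,f,k,m,n,o,p,q,s,r,t,u],
 ![a,b,g,c,h,d,i,e,l,j,f,k,m,n,p,o,q,r,s,t,u], ![a,b,g,c,h,d,i,e,l,j,f,k,m,n,p,o,q,s,r,t,u], ![a,b,g,c,h,d,i,e,l,j,f,k,m,p,n,o,q,r,s,t,u], ![a,b,g,c,h,d,i,e,l,j,f,m,k,n,p,o,q,r,s,t,u],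
 ![a,b,g,c,h,d,i,e,l,j,f,m,k,n,p,o,q,s,r,t,u], ![a,b,g,c,h,d,i,e,l,j,f,m,k,n,p,q,o,s,r,t,u], ![a,b,g,c,h,d,i,e,l,j,f,m,k,p,n,o,q,r,s,t,u], ![a,b,g,c,h,d,i,e,l,j,f,m,k,p,n,q,o,r,s,t,u],
 ![a,b,g,c,h,d,i,e,l,j,f,m,k,p,n,q,o,s,r,t,u], ![a,b,g,c,h,d,i,e,l,j,m,f,k,n,p,q,o,s,r,t,u], ![a,b,g,c,h,d,i,e,l,j,m,f,k,p,n,q,o,r,s,t,u], ![a,b,g,c,h,d,i,e,l,j,m,f,k,p,n,q,o,s,r,t,u] ]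
 else
 if N < 141 then
 [ -- block 140: chambers 2240…2255, four per line
 ![a,b,g,c,h,d,i,e,l,j,m,f,n,k,p,q,o,s,r,t,u], ![a,b,g,c,h,d,i,e,l,j,m,f,n,k,p,q,s,o,r,t,u], ![a,b,g,c,h,d,i,e,l,j,m,f,n,p,k,q,o,s,r,t,u], ![a,b,g,c,h,d,i,e,l,j,m,f,n,p,k,q,s,o,r,t,u],
 ![a,b,g,c,h,d,i,e,l,j,m,f,p,k,n,q,o,r,s,t,u], ![a,b,g,c,h,d,i,e,l,j,m,f,p,k,n,q,o,s,r,t,u], ![a,b,g,c,h,d,i,e,l,j,m,f,p,n,k,q,o,s,r,t,u], ![a,b,g,c,h,d,i,e,l,j,m,f,p,n,k,q,s,o,r,t,u],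
 ![a,b,g,c,h,d,i,e,l,j,m,n,f,k,p,q,s,o,r,t,u], ![a,b,g,c,h,d,i,e,l,j,m,n,f,p,k,q,s,o,r,t,u], ![a,b,g,c,h,d,i,e,l,j,m,n,p,f,k,q,s,o,r,t,u], ![a,b,g,c,h,d,i,e,l,j,m,n,p,f,q,k,s,o,r,t,u],
 ![a,b,g,c,h,d,i,e,l,j,m,n,p,q,f,k,s,o,r,t,u], ![a,b,g,c,h,d,i,e,l,j,m,n,p,q,f,s,k,o,r,t,u], ![a,b,g,c,h,d,i,e,l,j,m,n,p,q,s,f,k,o,r,t,u], ![a,b,g,c,h,d,i,e,l,j,m,p,f,k,n,q,o,r,s,t,u] ]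
 else
 [ -- block 141: chambers 2256…2271, four per line
 ![a,b,g,c,h,d,i,e,l,j,m,p,f,k,n,q,o,s,r,t,u], ![a,b,g,c,h,d,i,e,l,j,m,p,f,n,k,q,o,s,r,t,u], ![a,b,g,c,h,d,i,e,l,j,m,p,f,n,k,q,s,o,r,t,u], ![a,b,g,c,h,d,i,e,l,j,m,p,n,f,k,q,s,o,r,t,u],
 ![a,b,g,c,h,d,i,e,l,j,m,p,n,f,q,k,s,o,r,t,u], ![a,b,g,c,h,d,i,e,l,j,m,p,n,q,f,k,s,o,r,t,u], ![a,b,g,c,h,d,i,e,l,j,m,p,n,q,f,s,k,o,r,t,u], ![a,b,g,c,h,d,i,e,l,j,m,p,n,q,s,f,k,o,r,t,u],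
 ![a,b,g,c,h,d,i,l,e,f,j,k,m,n,o,p,q,r,s,t,u], ![a,b,g,c,h,d,i,l,e,f,j,k,m,n,p,o,q,r,s,t,u], ![a,b,g,c,h,d,i,l,e,f,j,k,m,p,n,o,q,r,s,t,u], ![a,b,g,c,h,d,i,l,e,f,j,m,k,n,p,o,q,r,s,t,u],
 ![a,b,g,c,h,d,i,l,e,f,j,m,k,p,n,o,q,r,s,t,u], ![a,b,g,c,h,d,i,l,e,f,m,j,k,p,n,o,q,r,s,t,u], ![a,b,g,c,h,d,i,l,e,j,f,k,m,n,o,p,q,r,s,t,u], ![a,b,g,c,h,d,i,l,e,j,f,k,m,n,o,p,q,s,r,t,u] ]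
 else
 if N < 152 then
 if N < 147 then
 if N < 144 then
 if N < 143 then
 [ -- block 142: chambers 2272…2287, four per line
 ![a,b,g,c,h,d,i,l,e,j,f,k,m,n,p,o,q,r,s,t,u], ![a,b,g,c,h,d,i,l,e,j,f,k,m,n,p,o,q,s,r,t,u], ![a,b,g,c,h,d,i,l,e,j,f,k,m,p,n,o,q,r,s,t,u], ![a,b,g,c,h,d,i,l,e,j,f,m,k,n,p,o,q,r,s,t,u],
 ![a,b,g,c,h,d,i,l,e,j,f,m,k,n,p,o,q,s,r,t,u], ![a,b,g,c,h,d,i,l,e,j,f,m,k,p,n,o,q,r,s,t,u], ![a,b,g,c,h,d,i,l,e,j,m,f,k,n,p,o,q,r,s,t,u], ![a,b,g,c,h,d,i,l,e,j,m,f,k,n,p,o,q,s,r,t,u],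
 ![a,b,g,c,h,d,i,l,e,j,m,f,k,n,p,q,o,s,r,t,u], ![a,b,g,c,h,d,i,l,e,j,m,f,k,p,n,o,q,r,s,t,u], ![a,b,g,c,h,d,i,l,e,j,m,f,k,p,n,q,o,r,s,t,u], ![a,b,g,c,h,d,i,l,e,j,m,f,k,p,n,q,o,s,r,t,u],
 ![a,b,g,c,h,d,i,l,e,j,m,f,n,k,p,q,o,s,r,t,u], ![a,b,g,c,h,d,i,l,e,j,m,f,n,p,k,q,o,s,r,t,u], ![a,b,g,c,h,d,i,l,e,j,m,f,p,k,n,q,o,r,s,t,u], ![a,b,g,c,h,d,i,l,e,j,m,f,p,k,n,q,o,s,r,t,u] ]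
 else
 [ -- block 143: chambers 2288…2303, four per line
 ![a,b,g,c,h,d,i,l,e,j,m,f,p,n,k,q,o,s,r,t,u], ![a,b,g,c,h,d,i,l,e,j,m,n,f,k,p,q,o,s,r,t,u], ![a,b,g,c,h,d,i,l,e,j,m,n,f,k,p,q,s,o,r,t,u], ![a,b,g,c,h,d,i,l,e,j,m,n,f,p,k,q,o,s,r,t,u],
 ![a,b,g,c,h,d,i,l,e,j,m,n,f,p,k,q,s,o,r,t,u], ![a,b,g,c,h,d,i,l,e,j,m,n,p,f,k,q,o,s,r,t,u], ![a,b,g,c,h,d,i,l,e,j,m,n,p,f,k,q,s,o,r,t,u], ![a,b,g,c,h,d,i,l,e,j,m,n,p,f,q,k,s,o,r,t,u],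
 ![a,b,g,c,h,d,i,l,e,j,m,n,p,q,f,k,s,o,r,t,u], ![a,b,g,c,h,d,i,l,e,j,m,n,p,q,f,s,k,o,r,t,u], ![a,b,g,c,h,d,i,l,e,j,m,n,p,q,s,f,k,o,r,t,u], ![a,b,g,c,h,d,i,l,e,j,m,p,f,k,n,q,o,r,s,t,u],
 ![a,b,g,c,h,d,i,l,e,j,m,p,f,k,n,q,o,s,r,t,u], ![a,b,g,c,h,d,i,l,e,j,m,p,f,n,k,q,o,s,r,t,u], ![a,b,g,c,h,d,i,l,e,j,m,p,n,f,k,q,o,s,r,t,u], ![a,b,g,c,h,d,i,l,e,j,m,p,n,f,k,q,s,o,r,t,u] ]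
 else
 if N < 145 then
 [ -- block 144: chambers 2304…2319, four per line
 ![a,b,g,c,h,d,i,l,e,j,m,p,n,f,q,k,s,o,r,t,u], ![a,b,g,c,h,d,i,l,e,j,m,p,n,q,f,k,s,o,r,t,u], ![a,b,g,c,h,d,i,l,e,j,m,p,n,q,f,s,k,o,r,t,u], ![a,b,g,c,h,d,i,l,e,j,m,p,n,q,s,f,k,o,r,t,u],
 ![a,b,g,c,h,d,i,l,e,m,f,j,k,p,n,o,q,r,s,t,u], ![a,b,g,c,h,d,i,l,e,m,f,j,p,k,n,o,q,r,s,t,u], ![a,b,g,c,h,d,i,l,e,m,j,f,k,p,n,o,q,r,s,t,u], ![a,b,g,c,h,d,i,l,e,m,j,f,p,k,n,o,q,r,s,t,u],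
 ![a,b,g,c,h,d,i,l,e,m,j,f,p,k,n,q,o,r,s,t,u], ![a,b,g,c,h,d,i,l,e,m,j,f,p,n,k,q,o,r,s,t,u], ![a,b,g,c,h,d,i,l,e,m,j,f,p,n,k,q,o,s,r,t,u], ![a,b,g,c,h,d,i,l,e,m,j,p,f,k,n,q,o,r,s,t,u],
 ![a,b,g,c,h,d,i,l,e,m,j,p,f,n,k,q,o,r,s,t,u], ![a,b,g,c,h,d,i,l,e,m,j,p,f,n,k,q,o,s,r,t,u], ![a,b,g,c,h,d,i,l,e,m,j,p,n,f,k,q,o,s,r,t,u], ![a,b,g,c,h,d,i,l,e,m,j,p,n,f,q,k,o,s,r,t,u] ]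
 else
 if N < 146 then
 [ -- block 145: chambers 2320…2335, four per line
 ![a,b,g,c,h,d,i,l,e,m,j,p,n,f,q,k,s,o,r,t,u], ![a,b,g,c,h,d,i,l,e,m,j,p,n,q,f,k,s,o,r,t,u], ![a,b,g,c,h,d,i,l,e,m,j,p,n,q,f,s,k,o,r,t,u], ![a,b,g,c,h,d,i,l,e,m,j,p,n,q,s,f,k,o,r,t,u],
 ![a,b,g,c,h,d,i,l,m,e,f,j,k,p,n,o,q,r,s,t,u], ![a,b,g,c,h,d,i,l,m,e,f,j,p,k,n,o,q,r,s,t,u], ![a,b,g,c,h,d,i,l,m,e,f,p,j,k,n,o,q,r,s,t,u], ![a,b,g,c,h,d,i,l,m,e,j,f,k,p,n,o,q,r,s,t,u],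
 ![a,b,g,c,h,d,i,l,m,e,j,f,p,k,n,o,q,r,s,t,u], ![a,b,g,c,h,d,i,l,m,e,j,p,f,k,n,o,q,r,s,t,u], ![a,b,g,c,h,d,i,l,m,e,j,p,f,k,n,q,o,r,s,t,u], ![a,b,g,c,h,d,i,l,m,e,j,p,f,n,k,q,o,r,s,t,u],
 ![a,b,g,c,h,d,i,l,m,e,j,p,n,f,k,q,o,r,s,t,u], ![a,b,g,c,h,d,i,l,m,e,j,p,n,f,k,q,o,s,r,t,u], ![a,b,g,c,h,d,i,l,m,e,j,p,n,f,q,k,o,s,r,t,u], ![a,b,g,c,h,d,i,l,m,e,j,p,n,q,f,k,o,s,r,t,u] ]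
 else
 [ -- block 146: chambers 2336…2351, four per line
 ![a,b,g,c,h,d,i,l,m,e,j,p,n,q,f,k,s,o,r,t,u], ![a,b,g,c,h,d,i,l,m,e,j,p,n,q,f,s,k,o,r,t,u], ![a,b,g,c,h,d,i,l,m,e,j,p,n,q,s,f,k,o,r,t,u], ![a,b,g,c,h,d,i,l,m,e,p,f,j,k,n,o,q,r,s,t,u],
 ![a,b,g,c,h,d,i,l,m,e,p,j,f,k,n,o,q,r,s,t,u], ![a,b,g,c,h,d,i,l,m,e,p,j,f,k,n,q,o,r,s,t,u], ![a,b,g,c,h,d,i,l,m,e,p,j,f,n,k,q,o,r,s,t,u], ![a,b,g,c,h,d,i,l,m,e,p,j,n,f,k,q,o,r,s,t,u],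
 ![a,b,g,c,h,d,i,l,m,e,p,j,n,f,q,k,o,r,s,t,u], ![a,b,g,c,h,d,i,l,m,e,p,j,n,f,q,k,o,s,r,t,u], ![a,b,g,c,h,d,i,l,m,e,p,j,n,q,f,k,o,s,r,t,u], ![a,b,g,c,h,d,i,l,m,e,p,j,n,q,f,k,s,o,r,t,u],
 ![a,b,g,c,h,d,i,l,m,e,p,j,n,q,f,s,k,o,r,t,u], ![a,b,g,c,h,d,i,l,m,e,p,j,n,q,s,f,k,o,r,t,u], ![a,b,g,c,h,d,i,l,m,p,e,f,j,k,n,o,q,r,s,t,u], ![a,b,g,c,h,d,i,l,m,p,e,j,f,k,n,o,q,r,s,t,u] ]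
 else
 if N < 149 then
 if N < 148 then
 [ -- block 147: chambers 2352…2367, four per line
 ![a,b,g,c,h,d,i,l,m,p,e,j,f,k,n,q,o,r,s,t,u], ![a,b,g,c,h,d,i,l,m,p,e,j,f,n,k,q,o,r,s,t,u], ![a,b,g,c,h,d,i,l,m,p,e,j,n,f,k,q,o,r,s,t,u], ![a,b,g,c,h,d,i,l,m,p,e,j,n,f,q,k,o,r,s,t,u],
 ![a,b,g,c,h,d,i,l,m,p,e,j,n,q,f,k,o,r,s,t,u], ![a,b,g,c,h,d,i,l,m,p,e,j,n,q,f,k,o,s,r,t,u], ![a,b,g,c,h,d,i,l,m,p,e,j,n,q,f,k,s,o,r,t,u], ![a,b,g,c,h,d,i,l,m,p,e,j,n,q,f,s,k,o,r,t,u],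
 ![a,b,g,c,h,d,i,l,m,p,e,j,n,q,s,f,k,o,r,t,u], ![a,b,g,c,h,d,l,e,f,i,j,k,m,n,o,p,q,r,s,t,u], ![a,b,g,c,h,d,l,e,f,i,j,k,m,n,o,p,q,s,r,t,u], ![a,b,g,c,h,d,l,e,i,f,j,k,m,n,o,p,q,r,s,t,u],
 ![a,b,g,c,h,d,l,e,i,f,j,k,m,n,o,p,q,s,r,t,u], ![a,b,g,c,h,d,l,e,i,f,j,m,k,n,o,p,q,r,s,t,u], ![a,b,g,c,h,d,l,e,i,f,j,m,k,n,o,p,q,s,r,t,u], ![a,b,g,c,h,d,l,e,i,f,j,m,k,n,p,o,q,r,s,t,u] ]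
 else
 [ -- block 148: chambers 2368…2383, four per line
 ![a,b,g,c,h,d,l,e,i,f,j,m,k,n,p,o,q,s,r,t,u], ![a,b,g,c,h,d,l,e,i,j,f,k,m,n,o,p,q,s,r,t,u], ![a,b,g,c,h,d,l,e,i,j,f,m,k,n,o,p,q,s,r,t,u], ![a,b,g,c,h,d,l,e,i,j,f,m,k,n,p,o,q,s,r,t,u],
 ![a,b,g,c,h,d,l,e,i,j,f,m,n,k,o,p,q,s,r,t,u], ![a,b,g,c,h,d,l,e,i,j,f,m,n,k,p,o,q,s,r,t,u], ![a,b,g,c,h,d,l,e,i,j,m,f,n,k,p,o,q,s,r,t,u], ![a,b,g,c,h,d,l,e,i,j,m,f,n,k,p,q,o,s,r,t,u],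
 ![a,b,g,c,h,d,l,e,i,j,m,f,n,p,k,q,o,s,r,t,u], ![a,b,g,c,h,d,l,e,i,j,m,n,f,k,p,q,o,s,r,t,u], ![a,b,g,c,h,d,l,e,i,j,m,n,f,k,p,q,s,o,r,t,u], ![a,b,g,c,h,d,l,e,i,j,m,n,f,p,k,q,o,s,r,t,u],
 ![a,b,g,c,h,d,l,e,i,j,m,n,f,p,k,q,s,o,r,t,u], ![a,b,g,c,h,d,l,e,i,j,m,n,f,p,q,k,s,o,r,t,u], ![a,b,g,c,h,d,l,e,i,j,m,n,f,p,q,s,k,o,r,t,u], ![a,b,g,c,h,d,l,e,i,j,m,n,p,f,q,k,s,o,r,t,u] ]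
 else
 if N < 150 then
 [ -- block 149: chambers 2384…2399, four per line
 ![a,b,g,c,h,d,l,e,i,j,m,n,p,f,q,s,k,o,r,t,u], ![a,b,g,c,h,d,l,e,i,j,m,n,p,q,f,s,k,o,r,t,u], ![a,b,g,c,h,d,l,e,i,j,m,n,p,q,s,f,k,o,r,t,u], ![a,b,g,c,h,d,l,i,e,f,j,k,m,n,o,p,q,r,s,t,u],
 ![a,b,g,c,h,d,l,i,e,f,j,m,k,n,o,p,q,r,s,t,u], ![a,b,g,c,h,d,l,i,e,f,j,m,k,n,p,o,q,r,s,t,u], ![a,b,g,c,h,d,l,i,e,f,m,j,k,n,o,p,q,r,s,t,u], ![a,b,g,c,h,d,l,i,e,f,m,j,k,n,p,o,q,r,s,t,u],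
 ![a,b,g,c,h,d,l,i,e,f,m,j,k,p,n,o,q,r,s,t,u], ![a,b,g,c,h,d,l,i,e,j,f,k,m,n,o,p,q,r,s,t,u], ![a,b,g,c,h,d,l,i,e,j,f,k,m,n,o,p,q,s,r,t,u], ![a,b,g,c,h,d,l,i,e,j,f,m,k,n,o,p,q,r,s,t,u],
 ![a,b,g,c,h,d,l,i,e,j,f,m,k,n,o,p,q,s,r,t,u], ![a,b,g,c,h,d,l,i,e,j,f,m,k,n,p,o,q,r,s,t,u], ![a,b,g,c,h,d,l,i,e,j,f,m,k,n,p,o,q,s,r,t,u], ![a,b,g,c,h,d,l,i,e,j,m,f,k,n,p,o,q,r,s,t,u] ]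
 else
 if N < 151 then
 [ -- block 150: chambers 2400…2415, four per line
 ![a,b,g,c,h,d,l,i,e,j,m,f,k,n,p,o,q,s,r,t,u], ![a,b,g,c,h,d,l,i,e,j,m,f,n,k,p,o,q,s,r,t,u], ![a,b,g,c,h,d,l,i,e,j,m,f,n,k,p,q,o,s,r,t,u], ![a,b,g,c,h,d,l,i,e,j,m,f,n,p,k,q,o,s,r,t,u],
 ![a,b,g,c,h,d,l,i,e,j,m,n,f,k,p,q,o,s,r,t,u], ![a,b,g,c,h,d,l,i,e,j,m,n,f,k,p,q,s,o,r,t,u], ![a,b,g,c,h,d,l,i,e,j,m,n,f,p,k,q,o,s,r,t,u], ![a,b,g,c,h,d,l,i,e,j,m,n,f,p,k,q,s,o,r,t,u],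
 ![a,b,g,c,h,d,l,i,e,j,m,n,p,f,k,q,o,s,r,t,u], ![a,b,g,c,h,d,l,i,e,j,m,n,p,f,k,q,s,o,r,t,u], ![a,b,g,c,h,d,l,i,e,j,m,n,p,f,q,k,s,o,r,t,u], ![a,b,g,c,h,d,l,i,e,j,m,n,p,q,f,k,s,o,r,t,u],
 ![a,b,g,c,h,d,l,i,e,j,m,n,p,q,f,s,k,o,r,t,u], ![a,b,g,c,h,d,l,i,e,j,m,n,p,q,s,f,k,o,r,t,u], ![a,b,g,c,h,d,l,i,e,m,f,j,k,n,p,o,q,r,s,t,u], ![a,b,g,c,h,d,l,i,e,m,f,j,k,p,n,o,q,r,s,t,u] ]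
 else
 [ -- block 151: chambers 2416…2431, four per line
 ![a,b,g,c,h,d,l,i,e,m,f,j,p,k,n,o,q,r,s,t,u], ![a,b,g,c,h,d,l,i,e,m,j,f,k,n,p,o,q,r,s,t,u], ![a,b,g,c,h,d,l,i,e,m,j,f,k,p,n,o,q,r,s,t,u], ![a,b,g,c,h,d,l,i,e,m,j,f,n,k,p,o,q,r,s,t,u],
 ![a,b,g,c,h,d,l,i,e,m,j,f,n,k,p,o,q,s,r,t,u], ![a,b,g,c,h,d,l,i,e,m,j,f,n,p,k,o,q,r,s,t,u], ![a,b,g,c,h,d,l,i,e,m,j,f,n,p,k,o,q,s,r,t,u], ![a,b,g,c,h,d,l,i,e,m,j,f,n,p,k,q,o,s,r,t,u],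
 ![a,b,g,c,h,d,l,i,e,m,j,f,p,k,n,o,q,r,s,t,u], ![a,b,g,c,h,d,l,i,e,m,j,f,p,n,k,o,q,r,s,t,u], ![a,b,g,c,h,d,l,i,e,m,j,f,p,n,k,q,o,r,s,t,u], ![a,b,g,c,h,d,l,i,e,m,j,f,p,n,k,q,o,s,r,t,u],
 ![a,b,g,c,h,d,l,i,e,m,j,n,f,p,k,q,o,s,r,t,u], ![a,b,g,c,h,d,l,i,e,m,j,n,p,f,k,q,o,s,r,t,u], ![a,b,g,c,h,d,l,i,e,m,j,n,p,f,q,k,o,s,r,t,u], ![a,b,g,c,h,d,l,i,e,m,j,n,p,f,q,k,s,o,r,t,u] ]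
 else
 if N < 157 then
 if N < 154 then
 if N < 153 then
 [ -- block 152: chambers 2432…2447, four per line
 ![a,b,g,c,h,d,l,i,e,m,j,n,p,q,f,k,s,o,r,t,u], ![a,b,g,c,h,d,l,i,e,m,j,n,p,q,f,s,k,o,r,t,u], ![a,b,g,c,h,d,l,i,e,m,j,n,p,q,s,f,k,o,r,t,u], ![a,b,g,c,h,d,l,i,e,m,j,p,f,n,k,q,o,r,s,t,u],
 ![a,b,g,c,h,d,l,i,e,m,j,p,f,n,k,q,o,s,r,t,u], ![a,b,g,c,h,d,l,i,e,m,j,p,n,f,k,q,o,s,r,t,u], ![a,b,g,c,h,d,l,i,e,m,j,p,n,f,q,k,o,s,r,t,u], ![a,b,g,c,h,d,l,i,e,m,j,p,n,f,q,k,s,o,r,t,u],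
 ![a,b,g,c,h,d,l,i,e,m,j,p,n,q,f,k,s,o,r,t,u], ![a,b,g,c,h,d,l,i,e,m,j,p,n,q,f,s,k,o,r,t,u], ![a,b,g,c,h,d,l,i,e,m,j,p,n,q,s,f,k,o,r,t,u], ![a,b,g,c,h,d,l,i,m,e,f,j,k,p,n,o,q,r,s,t,u],
 ![a,b,g,c,h,d,l,i,m,e,f,j,p,k,n,o,q,r,s,t,u], ![a,b,g,c,h,d,l,i,m,e,f,p,j,k,n,o,q,r,s,t,u], ![a,b,g,c,h,d,l,i,m,e,j,f,k,p,n,o,q,r,s,t,u], ![a,b,g,c,h,d,l,i,m,e,j,f,p,k,n,o,q,r,s,t,u] ]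
 else
 [ -- block 153: chambers 2448…2463, four per line
 ![a,b,g,c,h,d,l,i,m,e,j,f,p,n,k,o,q,r,s,t,u], ![a,b,g,c,h,d,l,i,m,e,j,p,f,k,n,o,q,r,s,t,u], ![a,b,g,c,h,d,l,i,m,e,j,p,f,n,k,o,q,r,s,t,u], ![a,b,g,c,h,d,l,i,m,e,j,p,f,n,k,q,o,r,s,t,u],
 ![a,b,g,c,h,d,l,i,m,e,j,p,n,f,k,q,o,r,s,t,u], ![a,b,g,c,h,d,l,i,m,e,j,p,n,f,k,q,o,s,r,t,u], ![a,b,g,c,h,d,l,i,m,e,j,p,n,f,q,k,o,s,r,t,u], ![a,b,g,c,h,d,l,i,m,e,j,p,n,q,f,k,o,s,r,t,u],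
 ![a,b,g,c,h,d,l,i,m,e,j,p,n,q,f,k,s,o,r,t,u], ![a,b,g,c,h,d,l,i,m,e,j,p,n,q,f,s,k,o,r,t,u], ![a,b,g,c,h,d,l,i,m,e,j,p,n,q,s,f,k,o,r,t,u], ![a,b,g,c,h,d,l,i,m,e,p,f,j,k,n,o,q,r,s,t,u],
 ![a,b,g,c,h,d,l,i,m,e,p,j,f,k,n,o,q,r,s,t,u], ![a,b,g,c,h,d,l,i,m,e,p,j,f,n,k,o,q,r,s,t,u], ![a,b,g,c,h,d,l,i,m,e,p,j,f,n,k,q,o,r,s,t,u], ![a,b,g,c,h,d,l,i,m,e,p,j,n,f,k,q,o,r,s,t,u] ]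
 else
 if N < 155 then
 [ -- block 154: chambers 2464…2479, four per line
 ![a,b,g,c,h,d,l,i,m,e,p,j,n,f,q,k,o,r,s,t,u], ![a,b,g,c,h,d,l,i,m,e,p,j,n,f,q,k,o,s,r,t,u], ![a,b,g,c,h,d,l,i,m,e,p,j,n,q,f,k,o,s,r,t,u], ![a,b,g,c,h,d,l,i,m,e,p,j,n,q,f,k,s,o,r,t,u],
 ![a,b,g,c,h,d,l,i,m,e,p,j,n,q,f,s,k,o,r,t,u], ![a,b,g,c,h,d,l,i,m,e,p,j,n,q,s,f,k,o,r,t,u], ![a,b,g,c,h,d,l,i,m,p,e,f,j,k,n,o,q,r,s,t,u], ![a,b,g,c,h,d,l,i,m,p,e,j,f,k,n,o,q,r,s,t,u],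
 ![a,b,g,c,h,d,l,i,m,p,e,j,f,n,k,o,q,r,s,t,u], ![a,b,g,c,h,d,l,i,m,p,e,j,f,n,k,q,o,r,s,t,u], ![a,b,g,c,h,d,l,i,m,p,e,j,n,f,k,q,o,r,s,t,u], ![a,b,g,c,h,d,l,i,m,p,e,j,n,f,q,k,o,r,s,t,u],
 ![a,b,g,c,h,d,l,i,m,p,e,j,n,q,f,k,o,r,s,t,u], ![a,b,g,c,h,d,l,i,m,p,e,j,n,q,f,k,o,s,r,t,u], ![a,b,g,c,h,d,l,i,m,p,e,j,n,q,f,k,s,o,r,t,u], ![a,b,g,c,h,d,l,i,m,p,e,j,n,q,f,s,k,o,r,t,u] ]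
 else
 if N < 156 then
 [ -- block 155: chambers 2480…2495, four per line
 ![a,b,g,c,h,d,l,i,m,p,e,j,n,q,s,f,k,o,r,t,u], ![a,b,g,c,h,l,d,e,f,i,j,k,m,n,o,p,q,r,s,t,u], ![a,b,g,c,h,l,d,e,f,i,j,k,m,n,o,p,q,s,r,t,u], ![a,b,g,c,h,l,d,e,i,f,j,k,m,n,o,p,q,r,s,t,u],
 ![a,b,g,c,h,l,d,e,i,f,j,k,m,n,o,p,q,s,r,t,u], ![a,b,g,c,h,l,d,e,i,f,j,m,k,n,o,p,q,r,s,t,u], ![a,b,g,c,h,l,d,e,i,f,j,m,k,n,o,p,q,s,r,t,u], ![a,b,g,c,h,l,d,e,i,j,f,k,m,n,o,p,q,s,r,t,u],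
 ![a,b,g,c,h,l,d,e,i,j,f,m,k,n,o,p,q,s,r,t,u], ![a,b,g,c,h,l,d,e,i,j,f,m,n,k,o,p,q,s,r,t,u], ![a,b,g,c,h,l,d,e,i,j,m,f,n,k,o,p,q,s,r,t,u], ![a,b,g,c,h,l,d,e,i,j,m,f,n,k,p,o,q,s,r,t,u],
 ![a,b,g,c,h,l,d,e,i,j,m,n,f,k,o,p,q,s,r,t,u], ![a,b,g,c,h,l,d,e,i,j,m,n,f,k,p,o,q,s,r,t,u], ![a,b,g,c,h,l,d,e,i,j,m,n,f,k,p,q,o,s,r,t,u], ![a,b,g,c,h,l,d,e,i,j,m,n,f,k,p,q,s,o,r,t,u] ]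
 else
 [ -- block 156: chambers 2496…2511, four per line
 ![a,b,g,c,h,l,d,e,i,j,m,n,f,p,k,q,o,s,r,t,u], ![a,b,g,c,h,l,d,e,i,j,m,n,f,p,k,q,s,o,r,t,u], ![a,b,g,c,h,l,d,e,i,j,m,n,f,p,q,k,s,o,r,t,u], ![a,b,g,c,h,l,d,e,i,j,m,n,f,p,q,s,k,o,r,t,u],
 ![a,b,g,c,h,l,d,e,i,j,m,n,p,f,q,k,s,o,r,t,u], ![a,b,g,c,h,l,d,e,i,j,m,n,p,f,q,s,k,o,r,t,u], ![a,b,g,c,h,l,d,e,i,j,m,n,p,q,f,s,k,o,r,t,u], ![a,b,g,c,h,l,d,e,i,j,m,n,p,q,s,f,k,o,r,t,u],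
 ![a,b,g,c,h,l,d,i,e,f,j,k,m,n,o,p,q,r,s,t,u], ![a,b,g,c,h,l,d,i,e,f,j,m,k,n,o,p,q,r,s,t,u], ![a,b,g,c,h,l,d,i,e,f,m,j,k,n,o,p,q,r,s,t,u], ![a,b,g,c,h,l,d,i,e,j,f,k,m,n,o,p,q,r,s,t,u],
 ![a,b,g,c,h,l,d,i,e,j,f,k,m,n,o,p,q,s,r,t,u], ![a,b,g,c,h,l,d,i,e,j,f,m,k,n,o,p,q,r,s,t,u], ![a,b,g,c,h,l,d,i,e,j,f,m,k,n,o,p,q,s,r,t,u], ![a,b,g,c,h,l,d,i,e,j,m,f,k,n,o,p,q,r,s,t,u] ]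
 else
 if N < 160 then
 if N < 158 then
 [ -- block 157: chambers 2512…2527, four per line
 ![a,b,g,c,h,l,d,i,e,j,m,f,k,n,o,p,q,s,r,t,u], ![a,b,g,c,h,l,d,i,e,j,m,f,k,n,p,o,q,r,s,t,u], ![a,b,g,c,h,l,d,i,e,j,m,f,k,n,p,o,q,s,r,t,u], ![a,b,g,c,h,l,d,i,e,j,m,f,n,k,o,p,q,s,r,t,u],
 ![a,b,g,c,h,l,d,i,e,j,m,f,n,k,p,o,q,s,r,t,u], ![a,b,g,c,h,l,d,i,e,j,m,n,f,k,o,p,q,s,r,t,u], ![a,b,g,c,h,l,d,i,e,j,m,n,f,k,p,o,q,s,r,t,u], ![a,b,g,c,h,l,d,i,e,j,m,n,f,k,p,q,o,s,r,t,u],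
 ![a,b,g,c,h,l,d,i,e,j,m,n,f,k,p,q,s,o,r,t,u], ![a,b,g,c,h,l,d,i,e,j,m,n,f,p,k,q,o,s,r,t,u], ![a,b,g,c,h,l,d,i,e,j,m,n,f,p,k,q,s,o,r,t,u], ![a,b,g,c,h,l,d,i,e,j,m,n,p,f,k,q,o,s,r,t,u],
 ![a,b,g,c,h,l,d,i,e,j,m,n,p,f,k,q,s,o,r,t,u], ![a,b,g,c,h,l,d,i,e,j,m,n,p,f,q,k,s,o,r,t,u], ![a,b,g,c,h,l,d,i,e,j,m,n,p,q,f,k,s,o,r,t,u], ![a,b,g,c,h,l,d,i,e,j,m,n,p,q,f,s,k,o,r,t,u] ]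
 else
 if N < 159 then
 [ -- block 158: chambers 2528…2543, four per line
 ![a,b,g,c,h,l,d,i,e,j,m,n,p,q,s,f,k,o,r,t,u], ![a,b,g,c,h,l,d,i,e,m,f,j,k,n,o,p,q,r,s,t,u], ![a,b,g,c,h,l,d,i,e,m,f,j,k,n,p,o,q,r,s,t,u], ![a,b,g,c,h,l,d,i,e,m,j,f,k,n,o,p,q,r,s,t,u],
 ![a,b,g,c,h,l,d,i,e,m,j,f,k,n,p,o,q,r,s,t,u], ![a,b,g,c,h,l,d,i,e,m,j,f,n,k,o,p,q,r,s,t,u], ![a,b,g,c,h,l,d,i,e,m,j,f,n,k,o,p,q,s,r,t,u], ![a,b,g,c,h,l,d,i,e,m,j,f,n,k,p,o,q,r,s,t,u],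
 ![a,b,g,c,h,l,d,i,e,m,j,f,n,k,p,o,q,s,r,t,u], ![a,b,g,c,h,l,d,i,e,m,j,f,n,p,k,o,q,r,s,t,u], ![a,b,g,c,h,l,d,i,e,m,j,f,n,p,k,o,q,s,r,t,u], ![a,b,g,c,h,l,d,i,e,m,j,n,f,k,o,p,q,s,r,t,u],
 ![a,b,g,c,h,l,d,i,e,m,j,n,f,k,p,o,q,s,r,t,u], ![a,b,g,c,h,l,d,i,e,m,j,n,f,p,k,o,q,s,r,t,u], ![a,b,g,c,h,l,d,i,e,m,j,n,f,p,k,q,o,s,r,t,u], ![a,b,g,c,h,l,d,i,e,m,j,n,p,f,k,q,o,s,r,t,u] ]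
 else
 [ -- block 159: chambers 2544…2559, four per line
 ![a,b,g,c,h,l,d,i,e,m,j,n,p,f,q,k,o,s,r,t,u], ![a,b,g,c,h,l,d,i,e,m,j,n,p,f,q,k,s,o,r,t,u], ![a,b,g,c,h,l,d,i,e,m,j,n,p,q,f,k,s,o,r,t,u], ![a,b,g,c,h,l,d,i,e,m,j,n,p,q,f,s,k,o,r,t,u],
 ![a,b,g,c,h,l,d,i,e,m,j,n,p,q,s,f,k,o,r,t,u], ![a,b,g,c,h,l,d,i,m,e,f,j,k,n,o,p,q,r,s,t,u], ![a,b,g,c,h,l,d,i,m,e,f,j,k,n,p,o,q,r,s,t,u], ![a,b,g,c,h,l,d,i,m,e,f,j,k,p,n,o,q,r,s,t,u],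
 ![a,b,g,c,h,l,d,i,m,e,f,j,p,k,n,o,q,r,s,t,u], ![a,b,g,c,h,l,d,i,m,e,f,p,j,k,n,o,q,r,s,t,u], ![a,b,g,c,h,l,d,i,m,e,j,f,k,n,o,p,q,r,s,t,u], ![a,b,g,c,h,l,d,i,m,e,j,f,k,n,p,o,q,r,s,t,u],
 ![a,b,g,c,h,l,d,i,m,e,j,f,k,p,n,o,q,r,s,t,u], ![a,b,g,c,h,l,d,i,m,e,j,f,n,k,o,p,q,r,s,t,u], ![a,b,g,c,h,l,d,i,m,e,j,f,n,k,p,o,q,r,s,t,u], ![a,b,g,c,h,l,d,i,m,e,j,f,n,p,k,o,q,r,s,t,u] ]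
 else
 if N < 161 then
 [ -- block 160: chambers 2560…2575, four per line
 ![a,b,g,c,h,l,d,i,m,e,j,f,p,k,n,o,q,r,s,t,u], ![a,b,g,c,h,l,d,i,m,e,j,f,p,n,k,o,q,r,s,t,u], ![a,b,g,c,h,l,d,i,m,e,j,n,f,k,o,p,q,r,s,t,u], ![a,b,g,c,h,l,d,i,m,e,j,n,f,k,o,p,q,s,r,t,u],
 ![a,b,g,c,h,l,d,i,m,e,j,n,f,k,p,o,q,r,s,t,u], ![a,b,g,c,h,l,d,i,m,e,j,n,f,k,p,o,q,s,r,t,u], ![a,b,g,c,h,l,d,i,m,e,j,n,f,p,k,o,q,r,s,t,u], ![a,b,g,c,h,l,d,i,m,e,j,n,f,p,k,o,q,s,r,t,u],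
 ![a,b,g,c,h,l,d,i,m,e,j,n,p,f,k,o,q,r,s,t,u], ![a,b,g,c,h,l,d,i,m,e,j,n,p,f,k,o,q,s,r,t,u], ![a,b,g,c,h,l,d,i,m,e,j,n,p,f,k,q,o,s,r,t,u], ![a,b,g,c,h,l,d,i,m,e,j,n,p,f,q,k,o,s,r,t,u],
 ![a,b,g,c,h,l,d,i,m,e,j,n,p,q,f,k,o,s,r,t,u], ![a,b,g,c,h,l,d,i,m,e,j,n,p,q,f,k,s,o,r,t,u], ![a,b,g,c,h,l,d,i,m,e,j,n,p,q,f,s,k,o,r,t,u], ![a,b,g,c,h,l,d,i,m,e,j,n,p,q,s,f,k,o,r,t,u] ]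
 else
 if N < 162 then
 [ -- block 161: chambers 2576…2591, four per line
 ![a,b,g,c,h,l,d,i,m,e,j,p,f,k,n,o,q,r,s,t,u], ![a,b,g,c,h,l,d,i,m,e,j,p,f,n,k,o,q,r,s,t,u], ![a,b,g,c,h,l,d,i,m,e,j,p,n,f,k,o,q,r,s,t,u], ![a,b,g,c,h,l,d,i,m,e,j,p,n,f,k,q,o,r,s,t,u],
 ![a,b,g,c,h,l,d,i,m,e,j,p,n,f,k,q,o,s,r,t,u], ![a,b,g,c,h,l,d,i,m,e,j,p,n,f,q,k,o,s,r,t,u], ![a,b,g,c,h,l,d,i,m,e,j,p,n,q,f,k,o,s,r,t,u], ![a,b,g,c,h,l,d,i,m,e,j,p,n,q,f,k,s,o,r,t,u],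
 ![a,b,g,c,h,l,d,i,m,e,j,p,n,q,f,s,k,o,r,t,u], ![a,b,g,c,h,l,d,i,m,e,j,p,n,q,s,f,k,o,r,t,u], ![a,b,g,c,h,l,d,i,m,e,p,f,j,k,n,o,q,r,s,t,u], ![a,b,g,c,h,l,d,i,m,e,p,j,f,k,n,o,q,r,s,t,u],
 ![a,b,g,c,h,l,d,i,m,e,p,j,f,n,k,o,q,r,s,t,u], ![a,b,g,c,h,l,d,i,m,e,p,j,n,f,k,o,q,r,s,t,u], ![a,b,g,c,h,l,d,i,m,e,p,j,n,f,k,q,o,r,s,t,u], ![a,b,g,c,h,l,d,i,m,e,p,j,n,f,q,k,o,r,s,t,u] ]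
 else
 [ -- block 162: chambers 2592…2607, four per line
 ![a,b,g,c,h,l,d,i,m,e,p,j,n,f,q,k,o,s,r,t,u], ![a,b,g,c,h,l,d,i,m,e,p,j,n,q,f,k,o,s,r,t,u], ![a,b,g,c,h,l,d,i,m,e,p,j,n,q,f,k,s,o,r,t,u], ![a,b,g,c,h,l,d,i,m,e,p,j,n,q,f,s,k,o,r,t,u],
 ![a,b,g,c,h,l,d,i,m,e,p,j,n,q,s,f,k,o,r,t,u], ![a,b,g,c,h,l,d,i,m,p,e,f,j,k,n,o,q,r,s,t,u], ![a,b,g,c,h,l,d,i,m,p,e,j,f,k,n,o,q,r,s,t,u], ![a,b,g,c,h,l,d,i,m,p,e,j,f,n,k,o,q,r,s,t,u],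
 ![a,b,g,c,h,l,d,i,m,p,e,j,n,f,k,o,q,r,s,t,u], ![a,b,g,c,h,l,d,i,m,p,e,j,n,f,k,q,o,r,s,t,u], ![a,b,g,c,h,l,d,i,m,p,e,j,n,f,q,k,o,r,s,t,u], ![a,b,g,c,h,l,d,i,m,p,e,j,n,q,f,k,o,r,s,t,u],
 ![a,b,g,c,h,l,d,i,m,p,e,j,n,q,f,k,o,s,r,t,u], ![a,b,g,c,h,l,d,i,m,p,e,j,n,q,f,k,s,o,r,t,u], ![a,b,g,c,h,l,d,i,m,p,e,j,n,q,f,s,k,o,r,t,u], ![a,b,g,c,h,l,d,i,m,p,e,j,n,q,s,f,k,o,r,t,u] ]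


/-- **The 2 608 pair-sum chambers of `(2,6)`, in 163 blocks of 16** (bookkeeping definition, nothing asserted; source of record:
theory g6 `HOME/theory/g6/chambers/chambers_2-6.jsonl`, ids `0 … 2607`; block `k` lists chambers `16k … 16k+15`; junk past the end = block 162).
Verbatim the census line's `chamberBlock`, assembled from the two halves. [folklore] -/
noncomputable def chamberBlock (N : ℕ) : List (Fin 21 → Fin 6 × Fin 6) :=
 if N < 81 then chamberBlockLo N else chamberBlockHi N

/-- **Chamber `n` of `(2,6)`** (`n < 2608`): the order `σₙ : Fin 21 → Fin 6 × Fin 6` of the 21 canonical pairs `(i, j)`, `i ≤ j`,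
by increasing pair sum `dᵢ + dⱼ` on chamber `n` of theory g6's table — the id used by the landed rows `doorA26_on_chamber<n>`
(e.g. `chamber 1002` is the `σ` of `…CensusChamber1002.lean` and `chamber 1002 = ![(0,0),(0,1),…]` holds by `rfl`, so a landed
row closes the instance `n = 1002` of a chamber-indexed statement by plain application).  The count `2 608 = |χ_𝒜(−1)|/6!`
(theory-2 CHAMBERS-COUNT-t2.md §2, Zaslavsky + 21 good primes; theory g6 exact-rational BFS; box enumeration `d₅ ≤ 80`) is NOT
asserted here; completeness of the table is the statement `stub_chamberCover` of the crux line `Cruxes/DoorA26/Lines/census.lean`.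
Junk value for `n ≥ 2608`: an entry of block 162.  Bookkeeping definition, nothing asserted. [folklore] -/
noncomputable def chamber (n : ℕ) : Fin 21 → Fin 6 × Fin 6 := (chamberBlock (n / 16)).getD (n % 16) (fun _ => (0, 0))

/-- Usage / sanity: `chamber 1002` is verbatim the `σ` of the landed row `doorA26_on_chamber1002`, definitionally. [folklore] -/
example : chamber 1002 = ![(0, 0), (0, 1), (0, 2), (1, 1), (0, 3), (0, 4), (1, 2), (0, 5), (1, 3), (2, 2), (1, 4),
    (2, 3), (1, 5), (2, 4), (3, 3), (2, 5), (3, 4), (4, 4), (3, 5), (4, 5), (5, 5)] := rfl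

/-- Sanity: the first and the last entry. [folklore] -/
example : chamber 0 = ![(0, 0), (0, 1), (0, 2), (0, 3), (0, 4), (0, 5), (1, 1), (1, 2), (1, 3), (1, 4), (1, 5),
    (2, 2), (2, 3), (2, 4), (2, 5), (3, 3), (3, 4), (3, 5), (4, 4), (4, 5), (5, 5)] ∧
  chamber 2607 = ![(0, 0), (0, 1), (1, 1), (0, 2), (1, 2), (2, 2), (0, 3), (1, 3), (2, 3), (3, 3), (0, 4),
    (1, 4), (2, 4), (3, 4), (4, 4), (0, 5), (1, 5), (2, 5), (3, 5), (4, 5), (5, 5)] := ⟨rfl, rfl⟩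

end Summit.ValiantsHypothesis.ValiantsHypothesis.Theorems.LacunarySymmetroidMatrixDescartes.Census
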